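import Mathlib
import Literature.Barriers.PneNP.MajorityMomentMatching
import Literature.Combinatorics.AssociationSchemes.SliceFKN
import Literature.Barriers.PneNP.TSPExtensionComplexityRothvossAssembly
import HarnessLib

/-!
# Barrier: bounded low-degree moment matching fails on block majorities — the SLICE version (the cell's (BSM) on `C([n],t)`)

Sixth barrier file of the cell pnp-psdrank (route `ChebyshevTracialDesign`, crux `TracialDecayExp20` = stmt-PneNP-19878);
the slice companion of `MajorityMomentMatching.lean` (barrier 5, the CUBE model). It proves lit memo LIT-41 §1 for the
object the cell actually uses: functions on the slice `C([n],t)` (`SliceFKN.slice n t = powersetCard t univ`) of low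
Johnson degree (`SliceFKN.HasDegreeLEOn`: agreement on the slice with `Σ_{|S| ≤ d} v_S·1[S ⊆ ·]`; equivalently, for the
bricks, membership in the span of the containment indicators `1[A' ⊆ U]`, `|A'| ≤ d`, on the odd cuts `OddSet n` — the
set in `Literature.Combinatorics.Optimization.IsLowDegreeU`). The prover's MEMO-21 §3(a) prices the amplitude class
`{f·BBᵀ}` of cut fields by SIGN-representatives as soon as
  (BSM) «every mask `f : C([n],t) → [0,1]` has a bounded function `g` of low Johnson degree (a bounded sum of squares
        with factors of degree `≤ c″`) whose moments of degree `≤ D′` match those of `f` to accuracy `e^{−aD}`»;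
        dual form: «for every `φ` of degree `≤ D′` with `E φ² = 1`: `E[φ₊] − sup_g E[φ·g] ≤ e^{−aD}`».
THIS FILE PROVES that (BSM) fails on the slice, already for test functions `φ` of Johnson degree `1`, with an explicit and
exactly computed deficiency: for every `N`-set `H ⊆ [n]`, `N = 2N'+1 ≤ t`, `N + t ≤ n`, with BLOCK SUM
`φ_H(U) = 2|U∩H| − N` and BLOCK MAJORITY `f_H = 1[φ_H > 0] = 1[|U∩H| > N/2]`, and every `g : C([n],t) → [0,1]` of Johnson
degree `≤ N − 1`,
  `E_{U ∈ C([n],t)}[φ_H(U)·(f_H(U) − g(U))] ≥ δ(n,t,N) := C(N−1,(N−1)/2)² / ( C(n,t) · Σ_{j ≤ N} C(N,j)/C(n−N,t−j) )`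
(**`expect_blockSum_mul_sub_ge`**, LIT-41 §1; `δ ≍ N^{−3/2}` in the cell's regime `N ≈ t ≈ n/2` — an inverse POLYNOMIAL,
against the route's `e^{−a·n^{1/4}}`; LIT-41 §3 tabulates `δ(82,41,39) = 2.005·10⁻³ … δ(2304,1151,1149) = 1.18·10⁻⁵`).
Architecture = LIT-41 §1 steps (i)–(v), with the Reynolds/Jensen step replaced by Cauchy–Schwarz against one vector:
* §2 slice combinatorics — the fibration `U ↦ (U ∩ H, U ∖ H)` (**`sum_slice_fibre`**), radial sums = the hypergeometric
  law of `|U ∩ H|` (**`sum_slice_radial`**), superset counts inside a ground set (`card_filter_superset_mul_choose`, from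
  Mathlib's `card_filter_powersetCard_subset` and `Nat.choose_mul`), and the SYMMETRISATION identity
  **`card_slice_superset_blockCard_mul`**: `#{U : A ⊆ U, |U∩H| = j}·C(N,a)C(n−N,b) = C(N,j)C(j,a)·C(n−N,t−j)C(t−j,b)`
  (`a = |A∩H|`, `b = |A∖H|`), i.e. `E[1[A⊆U] ∣ |U∩H| = j]` is the degree-`|A|` polynomial `C(j,a)C(t−j,b)/(C(N,a)C(n−N,b))`
  (LIT-41 §1 (iii): the hypergeometric analogue of symmetrisation to a function of `Σ x_i`);
* §3 **`alternating_sum_choose_mul_choose_sub`**: `Σ_{i ≤ K} (−1)^i C(K,i)·C(c−i,b) = 0` for `b < K ≤ c` — "the `K`-th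
  difference kills degree `< K`" (LIT-41 §1 (v)), from Mathlib's `fwdDiff_iter_choose` / `fwdDiff_iter_eq_sum_shift`;
* §4 ORTHOGONALITY of the TOP HAHN VECTOR `Ψ_H(U) = ψ(|U∩H|)`, `ψ(j) = (−1)^j / C(n−N, t−j)` (the `w`-dual of
  `(−1)^j C(N,j)`, `w` = hypergeometric weight) to every containment indicator `1[A ⊆ U]`, `|A| < N`
  (**`sum_minFn_mul_hahnTop_eq_zero`**), hence to every `g` of Johnson degree `< N` on the slice
  (`sum_mul_hahnTop_eq_zero_of_hasDegreeLEOn`);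
* §5 the two moments: `Σ_U f_H·Ψ_H = Σ_{j > N'} (−1)^j C(N,j) = (−1)^{N'+1} C(2N',N')` (**`sum_blockMaj_mul_hahnTop`**, via
  `MajorityMomentMatching.alternating_partial_sum` — the top coefficient of majority, O'Donnell Thm 5.19/Cor 5.20 in
  hypergeometric dress) and `Σ_U Ψ_H² = Z(n,t,N) = Σ_j C(N,j)/C(n−N,t−j)` (`sum_hahnTop_sq`);
* §6 the inequality: `φ_H(f_H − g) = |φ_H|·|f_H − g| ≥ (f_H − g)²` pointwise (`|φ_H| ≥ 1`: odd integer; `0 ≤ g ≤ 1`), then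
  Cauchy–Schwarz against `Ψ_H ⟂ g`: **`sum_blockSum_mul_sub_ge`** (`≥ C(2N',N')²/Z`), `expect_blockSum_mul_sub_ge_of_orth`,
  `expect_blockSum_mul_sub_ge` (Johnson degree `≤ d < N` via `HasDegreeLEOn`), and the bricks' currency
  **`expect_blockSum_mul_sub_ge_of_mem_span`** (`t` odd, `g : OddSet n → ℝ` in the `IsLowDegreeU` span, bounds on the
  `t`-cuts only);
* §7 the technique class `SliceMomentMatching n t d ε` and the BARRIER **`not_sliceMomentMatching`**;
* §8 (v2) CAPS AT EVERY THRESHOLD AND BLOCK SIZE (LIT-41 §4(2)'s test family `f_{H,h} = 1[|U∩H| ≥ h]`, both parities of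
  `|H|`): with `φ_{H,h} = 2|U∩H| − 2h + 1`, **`sum_capInd_mul_hahnTop`** (`⟨f_{H,h}, Ψ_H⟩ = (−1)^h C(N−1,h−1)`),
  **`sum_capSum_mul_sub_ge`**, **`expect_capSum_mul_sub_ge`**: `E[φ_{H,h}(f_{H,h} − g)] ≥ C(N−1,h−1)²/(C(n,t)·Z(n,t,N))`
  (`capDeficiency`) for every bounded `g` of Johnson degree `< N = |H|`, `1 ≤ h ≤ N` — strongest at the median
  (`blockMaj_eq_capInd`), exponentially weaker far from it;
* §9 (v3) the EXACT second moment `Σ_U φ_H² = blockSumSqSum n t N` (hypergeometric moments by double counting: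
  `sum_slice_blockCard`, `sum_slice_blockCard_sq`, `sum_blockSum_sq_eq`) and **`not_sliceMomentMatching_sharp`**
  (`ε < δ(n,t,N)/‖φ_H‖₂` with `‖φ_H‖₂² = blockSumSqSum/C(n,t)` — LIT-41 §3's normalised column, kernel-exact);
* §10 (v4) BLOCK SYMMETRISATION ON THE SLICE (Minsky–Papert over `S_H × S_{[n]∖H}`; LIT-41 §1 (iii) in full): `binomPoly`,
  `binomPolyRefl`, `blockSymPoly`, **`sum_slice_filter_blockCard_zeta`** and **`exists_blockSymmetrisation`** — every `g` of
  Johnson degree `≤ d` on `C([n],t)` has `Σ_{|U∩H| = j} g(U) = C(N,j)C(n−N,t−j)·P(j)` with `deg P ≤ d`, and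
  `Σ_U g(U)F(|U∩H|) = Σ_j C(N,j)C(n−N,t−j)P(j)F(j)` (the slice companion of `Literature.Computability.QuantumComplexity.symPoly`).

technique_class: SIGN-REPRESENTATIVE PRICING OF AMPLITUDE MASKS VIA BOUNDED LOW-DEGREE MOMENT MATCHING ON THE SLICE —
  «for every `φ : C([n],t) → ℝ` of Johnson degree `≤ 1` there is `g : C([n],t) → [0,1]` of Johnson degree `≤ d` with
  `E[φ·(1[φ>0] − g)] ≤ ε·‖φ‖₂`» (`SliceMomentMatching n t d ε`; homogeneous form of the normalised `E φ² = 1` version);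
  the cell's (BSM) (MEMO-21 §3(a)) is the case `φ` of degree `≤ D′`, `g ∈ bSOS_{c″}` (function degree `2c″ =: d`),
  `ε = e^{−aD}`. [cite: FilmusIhringer2019, §2 (p. 4: degree of a function on a domain of the slice)]
  [cite: ODonnell2014, Thm. 5.19 and Cor. 5.20 (§5.3: the cube prototype, majority)]
blocks: the route «(BSM) ⇒ the amplitude class `𝒜_k = {f·BBᵀ}` is priced by bricks 94b+95+96+slack» of MEMO-21 §3(a)–(b)
  ON THE SLICE ITSELF: for every `d < N = 2N'+1 ≤ t` with `N + t ≤ n` and every `ε < δ(n,t,N)/N`,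
  `SliceMomentMatching n t d ε` is false (`not_sliceMomentMatching`); with `N = 2c″+1 = t − 2k` (MEMO-21's degree budget,
  LIT-41 §2) the masks `f_H = Maj(U ∩ H)`, `|H| = N`, are not moment-matched to accuracy better than `δ/N ≍ N^{−5/2}` by any
  `[0,1]`-valued function of Johnson degree `≤ N − 1`, whereas the route needs `e^{−a·dq(n)}`, `dq(n) ≍ n^{1/4}`.
  [cite: ODonnell2014, Thm. 5.19 and Cor. 5.20 (§5.3)]
because: `φ_H(f_H − g) ≥ (f_H − g)²` pointwise and `E(f_H − g)² ≥ ⟨f_H − g, Ψ_H⟩²/‖Ψ_H‖² = ⟨f_H, Ψ_H⟩²/‖Ψ_H‖²` for the top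
  Hahn vector `Ψ_H ⟂ {Johnson degree < N}` — orthogonality because `E[1[A⊆U] ∣ |U∩H| = j]` is a polynomial of degree
  `|A| < N` in `j` and `Σ_j (−1)^j C(N,j) p(j) = 0` for `deg p < N`; `⟨f_H,Ψ_H⟩ = ±C(N−1,(N−1)/2)` is the partial alternating
  row sum (the top coefficient of majority). [cite: ODonnell2014, Thm. 5.19 and Cor. 5.20 (§5.3)]
  [cite: FilmusIhringer2019, §2 (p. 4)]
evasions_known: (i) masks whose Johnson degree is within the SIGN budget are priced directly (brick 96
  `Summit.PneNP.PneNP.Theorems.ChebyshevTracialDesignLowDegreeMasks.value_le_of_boolMask`): `f_H` has Johnson degree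
  exactly `|H|`, so this barrier (`|H| > d`) and brick 96 (`|H| + k ≤ c′`) are complementary in `|H|` (LIT-41 §4(2): median
  caps with `c″ < |H| ≤ 2c″` are decided by neither); (ii) the r-free ladder CG_k of MEMO-21 §3(b)–(c′) (bricks 98–101:
  CG_1 reduced to the pair-pinned design-value matrix of one `[0,1]`-function) does not go through representatives and is
  untouched — a mask defeating (BSM) may well be priced by CG_1's own mechanism; (iii) accuracy: at the cell's DESIGN
  scales (`n ≤ 2304`, `D = dq(n) ≤ 6`) the normalised deficiency is BELOW `e^{−aD}` for `a ≤ 2.4` (LIT-41 §3 table) — the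
  obstruction is asymptotic (`n → ∞` at fixed `a`), exactly like the crux's quantifiers. "none published" otherwise.
  [cite: ODonnell2014, §5.3]
scope_caveats: (a) NORMALISATION: the class is homogeneous in `φ` with `‖φ‖₂ = (E φ²)^{1/2}`; `not_sliceMomentMatching` bounds
  `‖φ_H‖₂ ≤ N` crudely (threshold `δ/N`), `not_sliceMomentMatching_sharp` (§9, v3) uses the exact `‖φ_H‖₂² = blockSumSqSum/C(n,t)`
  (`= 4·Var|U∩H| + (2E|U∩H| − N)² ≍ N(n−N)/n` per point) — LIT-41 §3's normalised column; (b) `δ(n,t,N)` is the exact closed form, its asymptotics `≍ N^{−3/2}` and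
  the design-scale table are LIT-41 §3 (two numeric lineages), not formalised; (c) test functions of degree `1` only and
  `g` merely BOUNDED of degree `≤ d` (both only strengthen the refutation: (BSM)'s `g` is moreover a sum of squares);
  (d) hypotheses `N ≤ t`, `N + t ≤ n` (`N ≤ min(t, n−t)`, LIT-41 §1) — in the cell `t ∈ {n/2, n/2 − 1}` odd and `N = t − 2`;
  (e) §8's cap bound `C(N−1,h−1)²/(C(n,t)Z)` decays exponentially in `N` for thresholds `h` far from `N/2` — there it is
  consistent with, and says nothing against, the approximability of far-from-median caps (LIT-39 (N1));
  (f) nothing here bears on the crux `TracialDecayExp20`, on CG_k, or on psd rank.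
status: established (elementary; this file = LIT-41 §1 made a kernel theorem).

References: LIT-41 (pnp-psdrank-lit g29, HOME/pnp-psdrank-lit/LIT-41.md, referee g58 PASS) for the statement, the degree
bookkeeping (§2) and the numbers (§3); MEMO-21 §3(a) (prover g18) for (BSM). Hahn polynomials (the hypergeometric
orthogonal polynomials; `Ψ_H` is the top one) are not needed by name — step (v) is self-contained.
Label: barrier / instrument for cell pnp-psdrank; no P-vs-NP content. No instances, no notation, standard axioms, 0 facts
(every declaration proved; the six `def`s are the witness vocabulary and the technique class).
-/

noncomputable section

open Finset
open Literature.Combinatorics.AssociationSchemes (JohnsonHarmonics.zeta JohnsonHarmonics.zeta_apply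
  SliceFKN.mem_slice SliceFKN.card_slice)
open Literature.Combinatorics.AssociationSchemes.SliceFKN (slice minFn HasDegreeLEOn
  affineFn affineFn_apply zeta_eq_affineFn_of_degree_le_one)
open Literature.Barriers.PneNP.MajorityMomentMatching (alternating_partial_sum four_pow_le_centralBinom)

namespace Literature.Barriers.PneNP.MajorityMomentMatchingSlice

variable {n : ℕ}

/-! ### §1 The objects: block sum, block majority, the top Hahn vector -/

/-- The block sum `φ_H(U) = 2|U ∩ H| − |H| = Σ_{i∈H} (2·1[i∈U] − 1)` (Johnson degree `1`).
[cite: ODonnell2014, §5.3 (Maj_n = sgn(Σ x_i); here the coordinates of the block H, read on the slice)] -/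
def blockSum (H U : Finset (Fin n)) : ℝ := 2 * ((U ∩ H).card : ℝ) - (H.card : ℝ)

/-- The block majority `f_H(U) = 1[φ_H(U) > 0] = 1[|U ∩ H| > |H|/2]`. [cite: ODonnell2014, §5.3] -/
def blockMaj (H U : Finset (Fin n)) : ℝ := if 0 < blockSum H U then 1 else 0

/-- The top Hahn coefficient `ψ(j) = (−1)^j / C(n−N, t−j)`: on the slice `C([n],t)` the function
`U ↦ ψ(|U∩H|)` (`|H| = N`) is orthogonal to every function of Johnson degree `< N`
(`sum_minFn_mul_hahnTop_eq_zero`). [folklore] -/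
def hahnCoeff (n t N j : ℕ) : ℝ := (-1) ^ j / (((n - N).choose (t - j) : ℕ) : ℝ)

/-- The top Hahn vector lifted to the slice: `Ψ_H(U) = ψ(|U ∩ H|)`. [folklore] -/
def hahnTop (n t : ℕ) (H U : Finset (Fin n)) : ℝ := hahnCoeff n t H.card (U ∩ H).card

/-- `Z(n,t,N) = Σ_{j ≤ N} C(N,j)/C(n−N,t−j)` (`= Σ_{U ∈ C([n],t)} Ψ_H(U)²`, `sum_hahnTop_sq`). [folklore] -/
def hahnNormSq (n t N : ℕ) : ℝ :=
  ∑ j ∈ range (N + 1), ((N.choose j : ℕ) : ℝ) / (((n - N).choose (t - j) : ℕ) : ℝ)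

/-- The deficiency `δ(n,t,N) = C(N−1,(N−1)/2)² / (C(n,t) · Z(n,t,N))` (LIT-41 §1: the exact squared
`L²`-distance, under the hypergeometric law of `|U∩H|`, from the block majority to the polynomials of
degree `≤ N−1` in `|U∩H|`). [folklore] -/
def deficiency (n t N : ℕ) : ℝ :=
  (((N - 1).choose ((N - 1) / 2) : ℕ) : ℝ) ^ 2 / ((n.choose t : ℝ) * hahnNormSq n t N)

/-! ### §2 Slice combinatorics: the fibration `U ↦ U ∩ H` -/

/-- On the fibre: `S ⊆ H`, `T ⊆ [n] ∖ H` ⇒ `(S ∪ T) ∩ H = S` (plumbing). [folklore] -/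
private theorem union_inter_eq_of_fibre {H S T : Finset (Fin n)} (hSH : S ⊆ H) (hT : T ⊆ univ \ H) :
    (S ∪ T) ∩ H = S := by
  ext i
  simp only [mem_inter, mem_union]
  constructor
  · rintro ⟨h | h, hiH⟩
    · exact h
    · exact absurd hiH (mem_sdiff.1 (hT h)).2
  · intro h
    exact ⟨Or.inl h, hSH h⟩

/-- On the fibre: `S ⊆ H`, `T ⊆ [n] ∖ H` ⇒ `(S ∪ T) ∖ H = T` (plumbing). [folklore] -/
private theorem union_sdiff_eq_of_fibre {H S T : Finset (Fin n)} (hSH : S ⊆ H) (hT : T ⊆ univ \ H) :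
    (S ∪ T) \ H = T := by
  ext i
  simp only [mem_sdiff, mem_union]
  constructor
  · rintro ⟨h | h, hiH⟩
    · exact absurd (hSH h) hiH
    · exact h
  · intro h
    exact ⟨Or.inr h, (mem_sdiff.1 (hT h)).2⟩

/-- On the fibre: `A ⊆ S ∪ T ↔ A ∩ H ⊆ S ∧ A ∖ H ⊆ T` (plumbing). [folklore] -/
private theorem subset_union_iff_of_fibre {H S T : Finset (Fin n)} (hSH : S ⊆ H) (hT : T ⊆ univ \ H)
    (A : Finset (Fin n)) : A ⊆ S ∪ T ↔ A ∩ H ⊆ S ∧ A \ H ⊆ T := by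
  constructor
  · intro h
    refine ⟨fun i hi => ?_, fun i hi => ?_⟩
    · rw [← union_inter_eq_of_fibre hSH hT]
      exact inter_subset_inter_right h hi
    · rw [← union_sdiff_eq_of_fibre hSH hT]
      exact sdiff_subset_sdiff h (le_refl H) hi
  · rintro ⟨h1, h2⟩ i hi
    by_cases hiH : i ∈ H
    · exact mem_union_left _ (h1 (mem_inter.2 ⟨hi, hiH⟩))
    · exact mem_union_right _ (h2 (mem_sdiff.2 ⟨hi, hiH⟩))

/-- **The fibration of the slice by `U ↦ U ∩ H`**: `Σ_{U ∈ C([n],t)} F(U) = Σ_{S ⊆ H, |S| ≤ t}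
Σ_{T ⊆ [n]∖H, |T| = t − |S|} F(S ∪ T)` (the bijection `U ↦ (U ∩ H, U ∖ H)` behind the hypergeometric counts of the
Johnson scheme). [cite: MacWilliamsSloane1977, Ch. 21 §6 Problem (10) (PDF p. 516: v_i = C(n,i)·C(l−n,i))] -/
theorem sum_slice_fibre (t : ℕ) (H : Finset (Fin n)) (F : Finset (Fin n) → ℝ) :
    ∑ U ∈ slice n t, F U =
      ∑ S ∈ H.powerset.filter (fun S => S.card ≤ t),
        ∑ T ∈ (univ \ H).powersetCard (t - S.card), F (S ∪ T) := by
  classical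
  have hmaps : ∀ U ∈ slice n t, U ∩ H ∈ H.powerset.filter (fun S => S.card ≤ t) := by
    intro U hU
    rw [SliceFKN.mem_slice] at hU
    simp only [mem_filter, mem_powerset]
    exact ⟨inter_subset_right, (card_le_card inter_subset_left).trans hU.le⟩
  rw [← sum_fiberwise_of_maps_to hmaps F]
  refine sum_congr rfl fun S hS => ?_
  simp only [mem_filter, mem_powerset] at hS
  obtain ⟨hSH, hSt⟩ := hS
  refine sum_nbij' (fun U => U \ H) (fun T => S ∪ T) ?_ ?_ ?_ ?_ ?_
  · intro U hU
    simp only [mem_filter, SliceFKN.mem_slice] at hU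
    obtain ⟨hUt, hUS⟩ := hU
    rw [mem_powersetCard]
    refine ⟨sdiff_subset_sdiff (subset_univ U) (le_refl H), ?_⟩
    have h := card_sdiff_add_card_inter U H
    rw [hUS, hUt] at h
    omega
  · intro T hT
    rw [mem_powersetCard] at hT
    obtain ⟨hTH, hTc⟩ := hT
    have hdisj : Disjoint S T := by
      refine disjoint_left.2 fun i hiS hiT => ?_
      exact (mem_sdiff.1 (hTH hiT)).2 (hSH hiS)
    simp only [mem_filter, SliceFKN.mem_slice]
    refine ⟨?_, union_inter_eq_of_fibre hSH hTH⟩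
    rw [card_union_of_disjoint hdisj, hTc]
    omega
  · intro U hU
    simp only [mem_filter, SliceFKN.mem_slice] at hU
    rw [← hU.2]
    ext i
    simp only [mem_union, mem_inter, mem_sdiff]
    tauto
  · intro T hT
    exact union_sdiff_eq_of_fibre hSH (mem_powersetCard.1 hT).1
  · intro U hU
    simp only [mem_filter, SliceFKN.mem_slice] at hU
    congr 1
    rw [← hU.2]
    ext i
    simp only [mem_union, mem_inter, mem_sdiff]
    tauto

/-- **Radial sums**: for `|H| = N ≤ t`, `Σ_{U ∈ C([n],t)} G(|U∩H|) = Σ_{j ≤ N} C(N,j)·C(n−N,t−j)·G(j)`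
(the hypergeometric law of `|U ∩ H|`; for `H` a point of the slice these are the valencies `v_i = C(n,i)C(l−n,i)` of the
Johnson scheme). [cite: MacWilliamsSloane1977, Ch. 21 §6 Problem (10) (PDF p. 516)] -/
theorem sum_slice_radial {t : ℕ} (H : Finset (Fin n)) (hHt : H.card ≤ t) (G : ℕ → ℝ) :
    ∑ U ∈ slice n t, G (U ∩ H).card =
      ∑ j ∈ range (H.card + 1), ((H.card.choose j : ℕ) : ℝ) * ((((n - H.card).choose (t - j) : ℕ) : ℝ) * G j) := by
  classical
  rw [sum_slice_fibre t H]
  have hfilter : H.powerset.filter (fun S => S.card ≤ t) = H.powerset :=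
    filter_true_of_mem fun S hS => (card_le_card (mem_powerset.1 hS)).trans hHt
  rw [hfilter]
  set f : ℕ → ℝ := fun k => (((n - H.card).choose (t - k) : ℕ) : ℝ) * G k with hf
  have hinner : ∀ S ∈ H.powerset, ∑ T ∈ (univ \ H).powersetCard (t - S.card), G ((S ∪ T) ∩ H).card =
      f S.card := by
    intro S hS
    have hSH := mem_powerset.1 hS
    rw [sum_congr rfl fun T hT => by rw [union_inter_eq_of_fibre hSH (mem_powersetCard.1 hT).1], sum_const,
      card_powersetCard, card_univ_sdiff, Fintype.card_fin, nsmul_eq_mul]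
  rw [sum_congr rfl hinner, sum_powerset_apply_card f]
  simp only [nsmul_eq_mul, hf]

/-- Supersets of `B` of size `s` inside a ground set `G`: `#{T ⊆ G : |T| = s, B ⊆ T}·C(|G|,|B|) =
C(|G|,s)·C(s,|B|)` (`= C(|G|−|B|, s−|B|)·C(|G|,|B|)` when `|B| ≤ s`, and `0 = 0` otherwise; the row sums of the
containment matrices `A_i` of the Johnson scheme). [cite: MacWilliamsSloane1977, Ch. 21 §6 Problem (11) (PDF p. 516: (A_i)_{x,ξ} = 1[ξ ⊂ x])] -/
theorem card_filter_superset_mul_choose (G B : Finset (Fin n)) (hBG : B ⊆ G) (s : ℕ) :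
    ((G.powersetCard s).filter (B ⊆ ·)).card * G.card.choose B.card = G.card.choose s * s.choose B.card := by
  classical
  by_cases hbs : B.card ≤ s
  · rw [card_filter_powersetCard_subset B G s hBG hbs, Nat.choose_mul hbs, Nat.mul_comm]
  · have hbs' : s < B.card := not_le.1 hbs
    have h0 : (G.powersetCard s).filter (B ⊆ ·) = ∅ := by
      refine filter_eq_empty_iff.2 fun T hT hBT => ?_
      have := card_le_card hBT
      rw [(mem_powersetCard.1 hT).2] at this
      omega
    rw [h0, card_empty, Nat.zero_mul, Nat.choose_eq_zero_of_lt hbs', Nat.mul_zero]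

/-- **Symmetrisation** (the hypergeometric analogue of "`E[1[A ⊆ x] ∣ Σx]` is a polynomial in `Σx`"):
for `|H| ≤ t`, every `A` (`a = |A ∩ H|`, `b = |A ∖ H|`) and every `j`,
`#{U ∈ C([n],t) : A ⊆ U, |U∩H| = j} · C(|H|,a)·C(n−|H|,b) = C(|H|,j)C(j,a) · C(n−|H|,t−j)C(t−j,b)`, i.e.
`E[1[A⊆U] ∣ |U∩H| = j] = C(j,a)C(t−j,b)/(C(|H|,a)C(n−|H|,b))`, a polynomial of degree `|A|` in `j` (LIT-41 §1 (iii);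
assembled from the Johnson-scheme counts). [cite: MacWilliamsSloane1977, Ch. 21 §6 Problems (10)–(11) (PDF p. 516)] -/
theorem card_slice_superset_blockCard_mul {t : ℕ} (H A : Finset (Fin n)) (hHt : H.card ≤ t) (j : ℕ) :
    ((slice n t).filter (fun U => A ⊆ U ∧ (U ∩ H).card = j)).card *
        (H.card.choose (A ∩ H).card * ((n - H.card).choose (A \ H).card)) =
      H.card.choose j * j.choose (A ∩ H).card *
        ((n - H.card).choose (t - j) * (t - j).choose (A \ H).card) := by
  classical
  have hA₁H : A ∩ H ⊆ H := inter_subset_right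
  have hBG : A \ H ⊆ univ \ H := sdiff_subset_sdiff (subset_univ A) (le_refl H)
  have hGcard : (univ \ H).card = n - H.card := by rw [card_univ_sdiff, Fintype.card_fin]
  -- everything as a real identity (casts of the counting lemmas)
  suffices h : ((((slice n t).filter (fun U => A ⊆ U ∧ (U ∩ H).card = j)).card : ℕ) : ℝ) *
      (((H.card.choose (A ∩ H).card : ℕ) : ℝ) * (((n - H.card).choose (A \ H).card : ℕ) : ℝ)) =
      ((H.card.choose j : ℕ) : ℝ) * ((j.choose (A ∩ H).card : ℕ) : ℝ) *
        ((((n - H.card).choose (t - j) : ℕ) : ℝ) * (((t - j).choose (A \ H).card : ℕ) : ℝ)) by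
    exact_mod_cast h
  rw [natCast_card_filter, sum_slice_fibre t H,
    filter_true_of_mem fun S hS => (card_le_card (mem_powerset.1 hS)).trans hHt]
  -- fibre sums
  have hT : ∀ S ∈ H.powerset, (∑ T ∈ (univ \ H).powersetCard (t - S.card),
      (if A ⊆ S ∪ T ∧ ((S ∪ T) ∩ H).card = j then (1 : ℝ) else 0)) * (((n - H.card).choose (A \ H).card : ℕ) : ℝ) =
      (if A ∩ H ⊆ S ∧ S.card = j then 1 else 0) *
        ((((n - H.card).choose (t - j) : ℕ) : ℝ) * (((t - j).choose (A \ H).card : ℕ) : ℝ)) := by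
    intro S hS
    have hSH := mem_powerset.1 hS
    have hval : ∀ T ∈ (univ \ H).powersetCard (t - S.card),
        (if A ⊆ S ∪ T ∧ ((S ∪ T) ∩ H).card = j then (1 : ℝ) else 0) =
          (if A ∩ H ⊆ S ∧ S.card = j then 1 else 0) * (if A \ H ⊆ T then 1 else 0) := by
      intro T hT
      have hTH := (mem_powersetCard.1 hT).1
      have hiff := subset_union_iff_of_fibre hSH hTH A
      rw [union_inter_eq_of_fibre hSH hTH]
      by_cases h1 : A ∩ H ⊆ S <;> by_cases h2 : A \ H ⊆ T <;> by_cases h3 : S.card = j <;>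
        simp [hiff, h1, h2, h3]
    rw [sum_congr rfl hval, ← mul_sum, sum_boole]
    by_cases hc : A ∩ H ⊆ S ∧ S.card = j
    · rw [if_pos hc, one_mul, one_mul, ← hc.2]
      have hcnt := card_filter_superset_mul_choose (univ \ H) (A \ H) hBG (t - S.card)
      rw [hGcard] at hcnt
      exact_mod_cast hcnt
    · rw [if_neg hc]
      simp
  have h1 : (∑ S ∈ H.powerset, ∑ T ∈ (univ \ H).powersetCard (t - S.card),
      (if A ⊆ S ∪ T ∧ ((S ∪ T) ∩ H).card = j then (1 : ℝ) else 0)) * (((n - H.card).choose (A \ H).card : ℕ) : ℝ) =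
      (∑ S ∈ H.powerset, (if A ∩ H ⊆ S ∧ S.card = j then (1 : ℝ) else 0)) *
        ((((n - H.card).choose (t - j) : ℕ) : ℝ) * (((t - j).choose (A \ H).card : ℕ) : ℝ)) := by
    rw [sum_mul, sum_congr rfl hT, ← sum_mul]
  -- the `S`-count: `#{S ⊆ H : |S| = j, A ∩ H ⊆ S}·C(|H|,a) = C(|H|,j)·C(j,a)`
  have hS : (∑ S ∈ H.powerset, (if A ∩ H ⊆ S ∧ S.card = j then (1 : ℝ) else 0)) *
      ((H.card.choose (A ∩ H).card : ℕ) : ℝ) = ((H.card.choose j : ℕ) : ℝ) * ((j.choose (A ∩ H).card : ℕ) : ℝ) := by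
    have hcnt := card_filter_superset_mul_choose H (A ∩ H) hA₁H j
    have hset : H.powerset.filter (fun S => A ∩ H ⊆ S ∧ S.card = j) = (H.powersetCard j).filter (A ∩ H ⊆ ·) := by
      ext S
      simp only [mem_filter, mem_powerset, mem_powersetCard]
      tauto
    rw [sum_boole, hset]
    exact_mod_cast hcnt
  linear_combination (((H.card.choose (A ∩ H).card : ℕ) : ℝ)) * h1 +
    ((((n - H.card).choose (t - j) : ℕ) : ℝ) * (((t - j).choose (A \ H).card : ℕ) : ℝ)) * hS

/-! ### §3 The `N`-th forward difference kills degree `< N` -/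

/-- `Δ^K C(·, b) ≡ 0` for `b < K` (iterated forward differences of a binomial coefficient of lower degree:
`Δ C(x, m+1) = C(x, m)`, then `Δ` of a constant vanishes). [cite: Aigner2007, §5.2 ¶"Difference Calculus" (Δ binom(x,m+1) = binom(x,m)) and §2.4 eq. (9)] -/
theorem fwdDiff_iter_choose_eq_zero_of_lt {b K : ℕ} (h : b < K) (y : ℕ) :
    (fwdDiff (1 : ℕ))^[K] (fun x : ℕ => (x.choose b : ℤ)) y = 0 := by
  obtain ⟨k, rfl⟩ := Nat.exists_eq_add_of_lt h
  have hb : (fwdDiff (1 : ℕ))^[b] (fun x : ℕ => (x.choose b : ℤ)) = fun x : ℕ => ((x.choose 0 : ℕ) : ℤ) := by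
    have := fwdDiff_iter_choose 0 b
    rwa [add_zero] at this
  rw [show b + k + 1 = k + 1 + b by ring, Function.iterate_add_apply, hb, Function.iterate_add_apply,
    Function.iterate_one]
  have h1 : (fun x : ℕ => ((x.choose 0 : ℕ) : ℤ)) = fun _ => 1 := by
    funext x; simp
  rw [h1, fwdDiff_const, fwdDiff_iter_eq_sum_shift]
  simp

/-- **`Σ_{i ≤ K} (−1)^i C(K,i)·C(c−i, b) = 0` for `b < K ≤ c`**: the `K`-th difference of the degree-`b`
polynomial `i ↦ C(c−i,b)` (binomial inversion: `Σ_k (−1)^{n−k} C(n,k) f(k) = 0` when `deg f < n`).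
[cite: Aigner2007, §2.4 ¶"Binomial Inversion", eq. (9)] -/
theorem alternating_sum_choose_mul_choose_sub (K c b : ℕ) (hbK : b < K) (hKc : K ≤ c) :
    ∑ i ∈ range (K + 1), (-1 : ℝ) ^ i * ((K.choose i : ℕ) : ℝ) * (((c - i).choose b : ℕ) : ℝ) = 0 := by
  -- the integer identity `Σ_k (−1)^{K−k} C(K,k) C(y+k,b) = Δ^K C(·,b) (y) = 0` at `y = c − K`
  have hz := fwdDiff_iter_choose_eq_zero_of_lt hbK (c - K)
  rw [fwdDiff_iter_eq_sum_shift] at hz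
  simp only [smul_eq_mul, mul_one] at hz
  -- reflect `i = K − k`
  rw [← sum_range_reflect]
  have hR : ∀ k ∈ range (K + 1), (-1 : ℝ) ^ (K + 1 - 1 - k) * ((K.choose (K + 1 - 1 - k) : ℕ) : ℝ) *
      (((c - (K + 1 - 1 - k)).choose b : ℕ) : ℝ) =
      (((-1 : ℤ) ^ (K - k) * ((K.choose k : ℕ) : ℤ) * (((c - K + k).choose b : ℕ) : ℤ) : ℤ) : ℝ) := by
    intro k hk
    have hkK : k ≤ K := by have := mem_range.1 hk; omega
    have h1 : K + 1 - 1 - k = K - k := by omega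
    rw [h1, Nat.choose_symm hkK, show c - (K - k) = c - K + k by omega]
    push_cast
    ring
  rw [sum_congr rfl hR, ← Int.cast_sum, hz, Int.cast_zero]

/-! ### §4 Orthogonality of the top Hahn vector to Johnson degree `< N` -/

/-- **Orthogonality**: for `|H| = N ≤ t`, `N + t ≤ n` and `|A| < N`,
`Σ_{U ∈ C([n],t)} 1[A ⊆ U]·Ψ_H(U) = 0` — the symmetrisation `E[1[A⊆U] ∣ |U∩H| = j] =
C(j,a)C(t−j,b)/(C(N,a)C(n−N,b))` (`a = |A∩H|`, `b = |A∖H|`) is a polynomial of degree `|A| < N` in `j`,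
killed by the `N`-th difference `Σ_j (−1)^j C(N,j)(·)` (LIT-41 §1 (iii)+(v)). [cite: Aigner2007, §2.4 eq. (9) (binomial inversion kills degree < n)]
[cite: MacWilliamsSloane1977, Ch. 21 §6 Problems (10)–(11) (PDF p. 516: Johnson-scheme counts)] -/
theorem sum_minFn_mul_hahnTop_eq_zero {t : ℕ} (H A : Finset (Fin n)) (hHt : H.card ≤ t)
    (hHn : H.card + t ≤ n) (hA : A.card < H.card) :
    ∑ U ∈ slice n t, minFn A U * hahnTop n t H U = 0 := by
  classical
  have hab : (A ∩ H).card + (A \ H).card = A.card := card_inter_add_card_sdiff A H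
  have hA₁H : A ∩ H ⊆ H := inter_subset_right
  have hBG : A \ H ⊆ univ \ H := sdiff_subset_sdiff (subset_univ A) (le_refl H)
  have hGcard : (univ \ H).card = n - H.card := by rw [card_univ_sdiff, Fintype.card_fin]
  have hbG : (A \ H).card ≤ n - H.card := by
    have := card_le_card hBG; rwa [hGcard] at this
  rw [sum_slice_fibre t H,
    filter_true_of_mem fun S hS => (card_le_card (mem_powerset.1 hS)).trans hHt]
  -- the fibre sums, in closed form
  set g : ℕ → ℝ := fun k => (-1 : ℝ) ^ k * (((t - k).choose (A \ H).card : ℕ) : ℝ) /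
    (((n - H.card).choose (A \ H).card : ℕ) : ℝ) with hg
  have hinner : ∀ S ∈ H.powerset,
      ∑ T ∈ (univ \ H).powersetCard (t - S.card), minFn A (S ∪ T) * hahnTop n t H (S ∪ T) =
        if A ∩ H ⊆ S then g S.card else 0 := by
    intro S hS
    have hSH := mem_powerset.1 hS
    have hSt : S.card ≤ t := (card_le_card hSH).trans hHt
    have hval : ∀ T ∈ (univ \ H).powersetCard (t - S.card),
        minFn A (S ∪ T) * hahnTop n t H (S ∪ T) =
          (if A ∩ H ⊆ S then hahnCoeff n t H.card S.card else 0) * (if A \ H ⊆ T then 1 else 0) := by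
      intro T hT
      have hTH := (mem_powersetCard.1 hT).1
      unfold hahnTop minFn
      rw [union_inter_eq_of_fibre hSH hTH]
      by_cases h1 : A ∩ H ⊆ S <;> by_cases h2 : A \ H ⊆ T <;>
        simp [h1, h2, subset_union_iff_of_fibre hSH hTH A]
    rw [sum_congr rfl hval, ← mul_sum, sum_boole]
    by_cases hAS : A ∩ H ⊆ S
    · rw [if_pos hAS, if_pos hAS]
      have hcnt := card_filter_superset_mul_choose (univ \ H) (A \ H) hBG (t - S.card)
      rw [hGcard] at hcnt
      have hposb : (0 : ℝ) < (((n - H.card).choose (A \ H).card : ℕ) : ℝ) := by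
        exact_mod_cast Nat.choose_pos hbG
      have hcnt' : ((((univ \ H).powersetCard (t - S.card)).filter (A \ H ⊆ ·)).card : ℝ) =
          (((n - H.card).choose (t - S.card) : ℕ) : ℝ) * (((t - S.card).choose (A \ H).card : ℕ) : ℝ) /
            (((n - H.card).choose (A \ H).card : ℕ) : ℝ) := by
        rw [eq_div_iff hposb.ne']
        exact_mod_cast hcnt
      rw [hcnt', hg]
      unfold hahnCoeff
      have hpos2 : (0 : ℝ) < (((n - H.card).choose (t - S.card) : ℕ) : ℝ) := by
        exact_mod_cast Nat.choose_pos (by omega)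
      field_simp
    · rw [if_neg hAS, if_neg hAS, zero_mul]
  rw [sum_congr rfl hinner, ← sum_filter]
  -- reindex `S = (A ∩ H) ∪ S'`, `S' ⊆ H ∖ (A ∩ H)`
  set g' : ℕ → ℝ := fun k => g ((A ∩ H).card + k) with hg'
  have hreindex : ∑ S ∈ H.powerset.filter (fun S => A ∩ H ⊆ S), g S.card =
      ∑ S' ∈ (H \ (A ∩ H)).powerset, g' S'.card := by
    refine sum_nbij' (fun S => S \ (A ∩ H)) (fun S' => (A ∩ H) ∪ S') ?_ ?_ ?_ ?_ ?_
    · intro S hS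
      simp only [mem_filter, mem_powerset] at hS
      exact mem_powerset.2 (sdiff_subset_sdiff hS.1 (le_refl _))
    · intro S' hS'
      have hS'sub := mem_powerset.1 hS'
      simp only [mem_filter, mem_powerset]
      exact ⟨union_subset hA₁H (hS'sub.trans sdiff_subset), subset_union_left⟩
    · intro S hS
      simp only [mem_filter, mem_powerset] at hS
      exact union_sdiff_of_subset hS.2
    · intro S' hS'
      have hS'sub := mem_powerset.1 hS'
      exact union_sdiff_cancel_left (disjoint_sdiff.mono_right hS'sub)
    · intro S hS
      simp only [mem_filter, mem_powerset] at hS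
      have hcard : (S \ (A ∩ H)).card + (A ∩ H).card = S.card := card_sdiff_add_card_eq_card hS.2
      rw [hg']
      simp only
      rw [show (A ∩ H).card + (S \ (A ∩ H)).card = S.card by omega]
  rw [hreindex, sum_powerset_apply_card g', card_sdiff_of_subset hA₁H]
  -- the alternating sum
  have hfinal : ∑ i ∈ range (H.card - (A ∩ H).card + 1), ((H.card - (A ∩ H).card).choose i) • g' i =
      (-1 : ℝ) ^ (A ∩ H).card / (((n - H.card).choose (A \ H).card : ℕ) : ℝ) *
        ∑ i ∈ range (H.card - (A ∩ H).card + 1), (-1 : ℝ) ^ i *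
          (((H.card - (A ∩ H).card).choose i : ℕ) : ℝ) *
          (((t - (A ∩ H).card - i).choose (A \ H).card : ℕ) : ℝ) := by
    rw [mul_sum]
    refine sum_congr rfl fun i _ => ?_
    rw [nsmul_eq_mul, hg', hg]
    simp only
    rw [pow_add, show t - ((A ∩ H).card + i) = t - (A ∩ H).card - i by omega]
    ring
  rw [hfinal, alternating_sum_choose_mul_choose_sub (H.card - (A ∩ H).card) (t - (A ∩ H).card) (A \ H).card
    (by omega) (by omega), mul_zero]

/-- Orthogonality for every function of Johnson degree `≤ d < N` on the slice (`HasDegreeLEOn`: agreement on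
`C([n],t)` with `Σ_{|S| ≤ d} v_S 1[S ⊆ ·]`). [cite: FilmusIhringer2019, §2 (p. 4: degree on a domain)]
[cite: Aigner2007, §2.4 eq. (9)] -/
theorem sum_mul_hahnTop_eq_zero_of_hasDegreeLEOn {t d : ℕ} {H : Finset (Fin n)} (hHt : H.card ≤ t)
    (hHn : H.card + t ≤ n) (hd : d < H.card) {g : Finset (Fin n) → ℝ} (hg : HasDegreeLEOn (slice n t) d g) :
    ∑ U ∈ slice n t, g U * hahnTop n t H U = 0 := by
  classical
  obtain ⟨v, hv, hgv⟩ := hg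
  have hexp : ∀ U ∈ slice n t, g U * hahnTop n t H U =
      ∑ T : Finset (Fin n), v T * (minFn T U * hahnTop n t H U) := by
    intro U hU
    rw [hgv U hU, JohnsonHarmonics.zeta_apply, sum_mul]
    have hpow : U.powerset = univ.filter (fun T => T ⊆ U) := by
      ext T; simp [mem_powerset]
    rw [hpow, sum_filter]
    refine sum_congr rfl fun T _ => ?_
    unfold minFn
    split_ifs <;> simp
  rw [sum_congr rfl hexp, sum_comm]
  refine sum_eq_zero fun T _ => ?_
  rw [← mul_sum]
  by_cases hT : d < T.card
  · rw [hv T hT, zero_mul]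
  · rw [sum_minFn_mul_hahnTop_eq_zero H T hHt hHn (by omega), mul_zero]

/-! ### §5 The two moments of the witness -/

/-- **`Σ_{U ∈ C([n],t)} f_H(U)·Ψ_H(U) = (−1)^{N'+1} C(2N',N')`** for `|H| = 2N'+1 ≤ t`, `|H| + t ≤ n`: the top
Hahn coefficient of the block majority is the partial alternating row sum `Σ_{j > N'} (−1)^j C(N,j)`.
[cite: ODonnell2014, Thm. 5.19 and Cor. 5.20 (§5.3: the cube analogue)] -/
theorem sum_blockMaj_mul_hahnTop {t N' : ℕ} (H : Finset (Fin n)) (hH : H.card = 2 * N' + 1)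
    (hHt : H.card ≤ t) (hHn : H.card + t ≤ n) :
    ∑ U ∈ slice n t, blockMaj H U * hahnTop n t H U = (-1) ^ (N' + 1) * (((2 * N').choose N' : ℕ) : ℝ) := by
  set G : ℕ → ℝ := fun j => (if (0 : ℝ) < 2 * (j : ℝ) - (H.card : ℝ) then 1 else 0) * hahnCoeff n t H.card j
    with hG
  have h1 : ∀ U ∈ slice n t, blockMaj H U * hahnTop n t H U = G (U ∩ H).card := fun U _ => rfl
  rw [sum_congr rfl h1, sum_slice_radial H hHt G]
  have h2 : ∀ j ∈ range (H.card + 1), ((H.card.choose j : ℕ) : ℝ) * ((((n - H.card).choose (t - j) : ℕ) : ℝ) * G j) =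
      (-1 : ℝ) ^ j * ((H.card.choose j : ℕ) : ℝ) -
        (if j < N' + 1 then (-1 : ℝ) ^ j * ((H.card.choose j : ℕ) : ℝ) else 0) := by
    intro j hj
    have hjN : j ≤ H.card := by have := mem_range.1 hj; omega
    have hpos : (0 : ℝ) < (((n - H.card).choose (t - j) : ℕ) : ℝ) := by
      exact_mod_cast Nat.choose_pos (by omega)
    rw [hG]
    unfold hahnCoeff
    by_cases hjs : j < N' + 1
    · have hneg : ¬ ((0 : ℝ) < 2 * (j : ℝ) - (H.card : ℝ)) := by
        rw [hH]; push_cast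
        have : (j : ℝ) ≤ N' := by exact_mod_cast (by omega : j ≤ N')
        linarith
      simp only [if_neg hneg, if_pos hjs]
      ring
    · have hposj : (0 : ℝ) < 2 * (j : ℝ) - (H.card : ℝ) := by
        rw [hH]; push_cast
        have : (N' : ℝ) + 1 ≤ j := by exact_mod_cast (by omega : N' + 1 ≤ j)
        linarith
      simp only [if_pos hposj, if_neg hjs]
      field_simp
      ring
  rw [sum_congr rfl h2, sum_sub_distrib, ← sum_filter]
  have hfull : ∑ j ∈ range (H.card + 1), (-1 : ℝ) ^ j * ((H.card.choose j : ℕ) : ℝ) = 0 := by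
    have := Int.alternating_sum_range_choose_of_ne (n := H.card) (by omega)
    exact_mod_cast this
  have hflt : (range (H.card + 1)).filter (fun j => j < N' + 1) = range (N' + 1) := by
    ext j; simp only [mem_filter, mem_range]; omega
  rw [hfull, hflt, hH, alternating_partial_sum (2 * N') N', pow_succ]
  ring

/-- **`Σ_{U ∈ C([n],t)} Ψ_H(U)² = Z(n,t,|H|)`** for `|H| ≤ t`, `|H| + t ≤ n` (a radial sum against the hypergeometric
counts). [cite: MacWilliamsSloane1977, Ch. 21 §6 Problem (10) (PDF p. 516)] -/
theorem sum_hahnTop_sq {t : ℕ} (H : Finset (Fin n)) (hHt : H.card ≤ t) (hHn : H.card + t ≤ n) :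
    ∑ U ∈ slice n t, hahnTop n t H U ^ 2 = hahnNormSq n t H.card := by
  set G : ℕ → ℝ := fun j => hahnCoeff n t H.card j ^ 2 with hG
  have h1 : ∀ U ∈ slice n t, hahnTop n t H U ^ 2 = G (U ∩ H).card := fun U _ => rfl
  rw [sum_congr rfl h1, sum_slice_radial H hHt G]
  unfold hahnNormSq
  refine sum_congr rfl fun j hj => ?_
  rw [hG]
  unfold hahnCoeff
  beta_reduce
  have hpos : (0 : ℝ) < (((n - H.card).choose (t - j) : ℕ) : ℝ) := by
    have := mem_range.1 hj
    exact_mod_cast Nat.choose_pos (by omega)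
  rw [div_pow, ← pow_mul, Even.neg_one_pow ⟨j, by ring⟩]
  field_simp

/-- `Z(n,t,N) > 0` when `N + t ≤ n` (all hypergeometric counts are positive). [cite: MacWilliamsSloane1977, Ch. 21 §6 Problem (10) (PDF p. 516)] -/
theorem hahnNormSq_pos {t N : ℕ} (hNn : N + t ≤ n) : 0 < hahnNormSq n t N := by
  unfold hahnNormSq
  refine sum_pos (fun j hj => ?_) ⟨0, by simp⟩
  have := mem_range.1 hj
  have h1 : (0 : ℝ) < ((N.choose j : ℕ) : ℝ) := by exact_mod_cast Nat.choose_pos (by omega)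
  have h2 : (0 : ℝ) < (((n - N).choose (t - j) : ℕ) : ℝ) := by exact_mod_cast Nat.choose_pos (by omega)
  positivity

/-- `δ(n,t,N) > 0` when `N + t ≤ n`. [cite: MacWilliamsSloane1977, Ch. 21 §6 Problem (10) (PDF p. 516)]
[cite: ODonnell2014, Thm. 5.19 and Cor. 5.20 (§5.3: C(N−1,(N−1)/2) ≠ 0, the top coefficient of majority)] -/
theorem deficiency_pos {t N : ℕ} (hNn : N + t ≤ n) : 0 < deficiency n t N := by
  unfold deficiency
  have h1 : (0 : ℝ) < (((N - 1).choose ((N - 1) / 2) : ℕ) : ℝ) := by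
    exact_mod_cast Nat.choose_pos (Nat.div_le_self _ _)
  have h2 : (0 : ℝ) < (n.choose t : ℝ) := by exact_mod_cast Nat.choose_pos (by omega)
  have h3 := hahnNormSq_pos hNn
  positivity

/-! ### §6 The inequality -/

/-- For `|H|` odd the block sum is an odd integer: `|φ_H| ≥ 1`. [cite: ODonnell2014, §5.3 (n odd)] -/
theorem one_le_abs_blockSum {H : Finset (Fin n)} (hH : Odd H.card) (U : Finset (Fin n)) :
    1 ≤ |blockSum H U| := by
  have hz : blockSum H U = (((2 * ((U ∩ H).card : ℤ) - (H.card : ℤ)) : ℤ) : ℝ) := by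
    unfold blockSum; push_cast; ring
  have hodd : Odd (2 * ((U ∩ H).card : ℤ) - (H.card : ℤ)) := (even_two_mul _).sub_odd hH.natCast
  have hne : (2 * ((U ∩ H).card : ℤ) - (H.card : ℤ)) ≠ 0 := by
    rintro h; rw [h] at hodd; exact (Int.not_odd_iff_even.2 (by decide : Even (0 : ℤ))) hodd
  rw [hz, ← Int.cast_abs]
  exact_mod_cast Int.one_le_abs hne

/-- The pointwise step: `|φ| ≥ 1`, `a ∈ [0,1]` ⇒ `(1[φ>0] − a)² ≤ φ·(1[φ>0] − a)`. [cite: ODonnell2014, §5.3] -/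
theorem sq_sub_le_mul_sub {φ a : ℝ} (hφ : 1 ≤ |φ|) (ha0 : 0 ≤ a) (ha1 : a ≤ 1) :
    ((if 0 < φ then (1 : ℝ) else 0) - a) ^ 2 ≤ φ * ((if 0 < φ then (1 : ℝ) else 0) - a) := by
  by_cases hpos : 0 < φ
  · rw [if_pos hpos]
    rw [abs_of_pos hpos] at hφ
    nlinarith
  · rw [if_neg hpos]
    have hneg : φ ≤ -1 := by
      rw [abs_of_nonpos (not_lt.1 hpos)] at hφ; linarith
    nlinarith

/-- **Block majority is not moment-matched by bounded functions orthogonal to the top Hahn vector**: for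
`|H| = 2N'+1 ≤ t`, `|H| + t ≤ n` and every `g : C([n],t) → [0,1]` with `Σ_U g(U)Ψ_H(U) = 0` (e.g. of Johnson
degree `< |H|`): `Σ_{U ∈ C([n],t)} φ_H(U)·(f_H(U) − g(U)) ≥ C(2N',N')² / Z(n,t,|H|)`.
[cite: ODonnell2014, Thm. 5.19 and Cor. 5.20 (§5.3: cube analogue)] -/
theorem sum_blockSum_mul_sub_ge {t N' : ℕ} (H : Finset (Fin n)) (hH : H.card = 2 * N' + 1)
    (hHt : H.card ≤ t) (hHn : H.card + t ≤ n) (g : Finset (Fin n) → ℝ)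
    (hg : ∀ U ∈ slice n t, 0 ≤ g U ∧ g U ≤ 1) (horth : ∑ U ∈ slice n t, g U * hahnTop n t H U = 0) :
    (((2 * N').choose N' : ℕ) : ℝ) ^ 2 / hahnNormSq n t H.card ≤
      ∑ U ∈ slice n t, blockSum H U * (blockMaj H U - g U) := by
  have hodd : Odd H.card := ⟨N', hH⟩
  -- Σ φ(f−g) ≥ Σ (f−g)²
  have h1 : ∑ U ∈ slice n t, (blockMaj H U - g U) ^ 2 ≤ ∑ U ∈ slice n t, blockSum H U * (blockMaj H U - g U) :=
    sum_le_sum fun U hU => sq_sub_le_mul_sub (one_le_abs_blockSum hodd U) (hg U hU).1 (hg U hU).2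
  -- Cauchy–Schwarz against Ψ_H
  have hcs := sum_mul_sq_le_sq_mul_sq (slice n t) (fun U => blockMaj H U - g U) (fun U => hahnTop n t H U)
  have hinner : ∑ U ∈ slice n t, (blockMaj H U - g U) * hahnTop n t H U =
      (-1) ^ (N' + 1) * (((2 * N').choose N' : ℕ) : ℝ) := by
    simp_rw [sub_mul]
    rw [sum_sub_distrib, horth, sub_zero, sum_blockMaj_mul_hahnTop H hH hHt hHn]
  rw [hinner, sum_hahnTop_sq H hHt hHn] at hcs
  have hsq : ((-1 : ℝ) ^ (N' + 1) * (((2 * N').choose N' : ℕ) : ℝ)) ^ 2 = (((2 * N').choose N' : ℕ) : ℝ) ^ 2 := by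
    rw [mul_pow, ← pow_mul, Even.neg_one_pow ⟨N' + 1, by ring⟩, one_mul]
  rw [hsq] at hcs
  have hZ := hahnNormSq_pos (n := n) hHn
  rw [div_le_iff₀ hZ]
  calc (((2 * N').choose N' : ℕ) : ℝ) ^ 2
      ≤ (∑ U ∈ slice n t, (blockMaj H U - g U) ^ 2) * hahnNormSq n t H.card := hcs
    _ ≤ (∑ U ∈ slice n t, blockSum H U * (blockMaj H U - g U)) * hahnNormSq n t H.card :=
        mul_le_mul_of_nonneg_right h1 hZ.le

/-- Expectation form of `sum_blockSum_mul_sub_ge`: `E_{U ∈ C([n],t)}[φ_H·(f_H − g)] ≥ δ(n,t,|H|)` for every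
bounded `g` orthogonal to `Ψ_H` on the slice. [cite: ODonnell2014, Thm. 5.19 and Cor. 5.20 (§5.3: cube analogue)] -/
theorem expect_blockSum_mul_sub_ge_of_orth {t N' : ℕ} (H : Finset (Fin n)) (hH : H.card = 2 * N' + 1)
    (hHt : H.card ≤ t) (hHn : H.card + t ≤ n) (g : Finset (Fin n) → ℝ)
    (hg : ∀ U ∈ slice n t, 0 ≤ g U ∧ g U ≤ 1) (horth : ∑ U ∈ slice n t, g U * hahnTop n t H U = 0) :
    deficiency n t H.card ≤ (∑ U ∈ slice n t, blockSum H U * (blockMaj H U - g U)) / (n.choose t : ℝ) := by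
  have hmain := sum_blockSum_mul_sub_ge H hH hHt hHn g hg horth
  have hC : (0 : ℝ) < (n.choose t : ℝ) := by exact_mod_cast Nat.choose_pos (by omega)
  have hZ := hahnNormSq_pos (n := n) hHn
  rw [le_div_iff₀ hC]
  unfold deficiency
  rw [hH] at hmain hZ ⊢
  rw [show 2 * N' + 1 - 1 = 2 * N' by omega, show 2 * N' / 2 = N' by omega]
  calc (((2 * N').choose N' : ℕ) : ℝ) ^ 2 / ((n.choose t : ℝ) * hahnNormSq n t (2 * N' + 1)) * (n.choose t : ℝ)
      = (((2 * N').choose N' : ℕ) : ℝ) ^ 2 / hahnNormSq n t (2 * N' + 1) := by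
        field_simp
    _ ≤ ∑ U ∈ slice n t, blockSum H U * (blockMaj H U - g U) := hmain

/-- **Expectation form, for every bounded `g` of Johnson degree `≤ d < |H|` on the slice** (LIT-41 §1):
`E_{U ∈ C([n],t)}[φ_H(U)·(f_H(U) − g(U))] ≥ δ(n,t,|H|)`. [cite: FilmusIhringer2019, §2 (p. 4: degree on a domain)]
[cite: ODonnell2014, Thm. 5.19 and Cor. 5.20 (§5.3: cube analogue)] -/
theorem expect_blockSum_mul_sub_ge {t d N' : ℕ} (H : Finset (Fin n)) (hH : H.card = 2 * N' + 1)
    (hHt : H.card ≤ t) (hHn : H.card + t ≤ n) (hd : d < H.card) (g : Finset (Fin n) → ℝ)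
    (hg : ∀ U ∈ slice n t, 0 ≤ g U ∧ g U ≤ 1) (hdeg : HasDegreeLEOn (slice n t) d g) :
    deficiency n t H.card ≤ (∑ U ∈ slice n t, blockSum H U * (blockMaj H U - g U)) / (n.choose t : ℝ) :=
  expect_blockSum_mul_sub_ge_of_orth H hH hHt hHn g hg (sum_mul_hahnTop_eq_zero_of_hasDegreeLEOn hHt hHn hd hdeg)

/-- **The same in the currency of the cell's bricks** (`Literature.Combinatorics.Optimization.IsLowDegreeU`:
masks `g : OddSet n → ℝ` in the span of the containment indicators `1[A' ⊆ U]`, `|A'| ≤ d`, on the odd cuts;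
`t` odd, expectation over the `t`-cuts): `E_{|U| = t}[φ_H(U)·(f_H(U) − g(U))] ≥ δ(n,t,|H|)` whenever `d < |H|`.
[cite: LeeRaghavendraSteurer2015, §5 (low-degree functions: the span)] [cite: ODonnell2014, Thm. 5.19 and Cor. 5.20 (§5.3)] -/
theorem expect_blockSum_mul_sub_ge_of_mem_span {t d N' : ℕ} (ht : Odd t) (H : Finset (Fin n))
    (hH : H.card = 2 * N' + 1) (hHt : H.card ≤ t) (hHn : H.card + t ≤ n) (hd : d < H.card) (g : OddSet n → ℝ)
    (hg : g ∈ Submodule.span ℝ (Set.range fun A' : {A' : Finset (Fin n) // A'.card ≤ d} =>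
      fun U : OddSet n => if A'.1 ⊆ U.1 then (1 : ℝ) else 0))
    (hg01 : ∀ U : OddSet n, U.1.card = t → 0 ≤ g U ∧ g U ≤ 1) :
    deficiency n t H.card ≤
      (∑ U ∈ (univ : Finset (OddSet n)).filter (fun U => U.1.card = t),
        blockSum H U.1 * (blockMaj H U.1 - g U)) / (n.choose t : ℝ) := by
  classical
  obtain ⟨c, hc⟩ := (Submodule.mem_span_range_iff_exists_fun ℝ).1 hg
  -- the extension of `g` to all subsets, with the same coefficients
  set G : Finset (Fin n) → ℝ := fun V => ∑ A' : {A' : Finset (Fin n) // A'.card ≤ d}, c A' * minFn A'.1 V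
    with hGdef
  have hgG : ∀ U : OddSet n, g U = G U.1 := by
    intro U
    rw [← hc, hGdef]
    simp only [Finset.sum_apply, Pi.smul_apply, smul_eq_mul]
    rfl
  have horth : ∑ V ∈ slice n t, G V * hahnTop n t H V = 0 := by
    have hexp : ∀ V ∈ slice n t, G V * hahnTop n t H V =
        ∑ A' : {A' : Finset (Fin n) // A'.card ≤ d}, c A' * (minFn A'.1 V * hahnTop n t H V) := by
      intro V _
      rw [hGdef, sum_mul]
      exact sum_congr rfl fun A' _ => by ring
    rw [sum_congr rfl hexp, sum_comm]
    refine sum_eq_zero fun A' _ => ?_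
    rw [← mul_sum, sum_minFn_mul_hahnTop_eq_zero H A'.1 hHt hHn (A'.2.trans_lt hd), mul_zero]
  have hG01 : ∀ V ∈ slice n t, 0 ≤ G V ∧ G V ≤ 1 := by
    intro V hV
    rw [SliceFKN.mem_slice] at hV
    have hodd : Odd V.card := by rw [hV]; exact ht
    have := hg01 ⟨V, hodd⟩ hV
    rwa [hgG] at this
  have hsum : ∑ U ∈ (univ : Finset (OddSet n)).filter (fun U => U.1.card = t),
      blockSum H U.1 * (blockMaj H U.1 - g U) = ∑ V ∈ slice n t, blockSum H V * (blockMaj H V - G V) := by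
    refine sum_bij (fun U _ => U.1) ?_ ?_ ?_ ?_
    · intro U hU
      simp only [mem_filter, mem_univ, true_and] at hU
      exact SliceFKN.mem_slice.2 hU
    · intro U₁ _ U₂ _ h
      exact Subtype.ext h
    · intro V hV
      rw [SliceFKN.mem_slice] at hV
      exact ⟨⟨V, by rw [hV]; exact ht⟩, by simp [mem_filter, hV], rfl⟩
    · intro U _
      rw [hgG]
  rw [hsum]
  exact expect_blockSum_mul_sub_ge_of_orth H hH hHt hHn G hG01 horth

/-! ### §7 The technique class and the barrier -/

/-- **The technique class** — the cell's (BSM) in dual form on the slice `C([n],t)`, already for test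
functions of Johnson degree `1`: every `φ` of degree `≤ 1` on the slice admits a `[0,1]`-valued `g` of
degree `≤ d` on the slice with `E[φ·(1[φ>0] − g)] ≤ ε·‖φ‖₂` (`‖φ‖₂² = E φ²`; written homogeneously in `φ`,
equivalent to the normalised form `E φ² = 1`). [cite: FilmusIhringer2019, §2 (p. 4: degree on a domain)] -/
def SliceMomentMatching (n t d : ℕ) (ε : ℝ) : Prop :=
  ∀ φ : Finset (Fin n) → ℝ, HasDegreeLEOn (slice n t) 1 φ →
    ∃ g : Finset (Fin n) → ℝ, (∀ U ∈ slice n t, 0 ≤ g U ∧ g U ≤ 1) ∧ HasDegreeLEOn (slice n t) d g ∧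
      ∑ U ∈ slice n t, φ U * ((if 0 < φ U then 1 else 0) - g U) ≤
        ε * Real.sqrt ((n.choose t : ℝ) * ∑ U ∈ slice n t, φ U ^ 2)

/-- The block sum has Johnson degree `1` (on every domain): `φ_H = −|H| + Σ_{i ∈ H} 2·x_i`.
[cite: FilmusIhringer2019, §2 (p. 4)] -/
theorem hasDegreeLEOn_blockSum (𝒟 : Finset (Finset (Fin n))) (H : Finset (Fin n)) :
    HasDegreeLEOn 𝒟 1 (blockSum H) := by
  classical
  set v : Finset (Fin n) → ℝ := fun S =>
    if S.card = 0 then -(H.card : ℝ) else if S.card = 1 then (if S ⊆ H then 2 else 0) else 0 with hv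
  have hv1 : ∀ S : Finset (Fin n), 1 < S.card → v S = 0 := by
    intro S hS; rw [hv]; simp only; rw [if_neg (by omega), if_neg (by omega)]
  refine ⟨v, hv1, fun U _ => ?_⟩
  rw [zeta_eq_affineFn_of_degree_le_one hv1, affineFn_apply, hv]
  simp only [card_empty, if_true, card_singleton, one_ne_zero, if_false, singleton_subset_iff]
  unfold blockSum
  rw [← sum_filter, sum_const, nsmul_eq_mul, filter_mem_eq_inter]
  ring

/-- `Σ_{U ∈ C([n],t)} φ_H(U)² ≤ C(n,t)·|H|²` (`|φ_H| ≤ |H|` pointwise; plumbing for the barrier). [folklore] -/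
private theorem sum_blockSum_sq_le (t : ℕ) (H : Finset (Fin n)) :
    ∑ U ∈ slice n t, blockSum H U ^ 2 ≤ (n.choose t : ℝ) * (H.card : ℝ) ^ 2 := by
  have h : ∀ U ∈ slice n t, blockSum H U ^ 2 ≤ (H.card : ℝ) ^ 2 := by
    intro U _
    have h0 : (0 : ℝ) ≤ ((U ∩ H).card : ℝ) := by positivity
    have h1 : ((U ∩ H).card : ℝ) ≤ H.card := by exact_mod_cast card_le_card inter_subset_right
    unfold blockSum
    apply sq_le_sq' <;> linarith
  refine (sum_le_sum h).trans ?_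
  rw [sum_const, SliceFKN.card_slice, nsmul_eq_mul]

/-- **BARRIER: bounded low-degree moment matching fails on the slice** (the cell's (BSM), LIT-41 §1–§2). For
`N = 2N'+1 ≤ t` with `N + t ≤ n`, every `d < N` and every `ε < δ(n,t,N)/N`, `SliceMomentMatching n t d ε` is
false — witnessed by the block sum `φ_H` of any `N`-set `H` (block majority `f_H = 1[φ_H > 0]`).
[cite: ODonnell2014, Thm. 5.19 and Cor. 5.20 (§5.3: cube analogue)] [cite: FilmusIhringer2019, §2 (p. 4)] -/
theorem not_sliceMomentMatching {t d N' : ℕ} (hNt : 2 * N' + 1 ≤ t) (hNn : 2 * N' + 1 + t ≤ n)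
    (hd : d < 2 * N' + 1) {ε : ℝ} (hε : ε < deficiency n t (2 * N' + 1) / (2 * N' + 1)) :
    ¬ SliceMomentMatching n t d ε := by
  classical
  intro h
  obtain ⟨H, -, hH⟩ := exists_subset_card_eq (s := (univ : Finset (Fin n))) (n := 2 * N' + 1)
    (by rw [card_univ, Fintype.card_fin]; omega)
  have hHt : H.card ≤ t := by rw [hH]; exact hNt
  have hHn : H.card + t ≤ n := by rw [hH]; exact hNn
  obtain ⟨g, hg01, hgdeg, hgε⟩ := h (blockSum H) (hasDegreeLEOn_blockSum _ H)
  have hlow := expect_blockSum_mul_sub_ge H hH hHt hHn (by rw [hH]; exact hd) g hg01 hgdeg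
  have hC : (0 : ℝ) < (n.choose t : ℝ) := by exact_mod_cast Nat.choose_pos (by omega)
  have hδ := deficiency_pos (n := n) hNn
  rw [hH, le_div_iff₀ hC] at hlow
  have hind : ∀ U, (if 0 < blockSum H U then (1 : ℝ) else 0) = blockMaj H U := fun U => rfl
  simp_rw [hind] at hgε
  -- `√(C(n,t)·Σφ²) ≤ C(n,t)·N`
  have hsqrt : Real.sqrt ((n.choose t : ℝ) * ∑ U ∈ slice n t, blockSum H U ^ 2) ≤
      (n.choose t : ℝ) * (2 * N' + 1) := by
    rw [Real.sqrt_le_left (by positivity)]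
    have := sum_blockSum_sq_le t H
    rw [hH] at this; push_cast at this
    nlinarith
  have hNpos : (0 : ℝ) < 2 * N' + 1 := by positivity
  rw [lt_div_iff₀ hNpos] at hε
  by_cases hε0 : 0 ≤ ε
  · have : deficiency n t (2 * N' + 1) * (n.choose t : ℝ) ≤ ε * ((n.choose t : ℝ) * (2 * N' + 1)) :=
      hlow.trans (hgε.trans (mul_le_mul_of_nonneg_left hsqrt hε0))
    nlinarith
  · have hε0' : ε < 0 := not_le.1 hε0
    have : ε * Real.sqrt ((n.choose t : ℝ) * ∑ U ∈ slice n t, blockSum H U ^ 2) ≤ 0 :=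
      mul_nonpos_of_nonpos_of_nonneg hε0'.le (Real.sqrt_nonneg _)
    nlinarith

/-! ### §8 Caps at every threshold, every block size (both parities)

LIT-41 §4(2) names the test family `f_{H,h} = 1[|U ∩ H| ≥ h]` ("caps"; median caps `h = ⌈|H|/2⌉`). The five lines of §6 run
for EVERY block size `N = |H| ≥ 1` and EVERY threshold `1 ≤ h ≤ N` with the odd-integer test function
`φ_{H,h} = 2|U∩H| − 2h + 1` (Johnson degree `1`, `1[φ_{H,h} > 0] = f_{H,h}`): the top Hahn coefficient of the cap is
`Σ_{j ≥ h} (−1)^j C(N,j) = (−1)^h C(N−1,h−1)`, so `E[φ_{H,h}(f_{H,h} − g)] ≥ C(N−1,h−1)² / (C(n,t)·Z(n,t,N))` for every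
bounded `g` of Johnson degree `< N` — strongest at the median (`C(N−1,h−1) ≍ 2^N/√N`, the case of §6–§7: `blockMaj H =
capInd H (N'+1)` for `N = 2N'+1`), exponentially weaker for thresholds far from it (consistent with the approximability of
far-from-median caps, LIT-39 (N1) / LIT-41 §4(2)). -/

/-- The cap test function `φ_{H,h}(U) = 2|U ∩ H| − 2h + 1` (an odd integer; Johnson degree `1`).
[cite: ODonnell2014, §5.3 (linear threshold functions of Σ x_i)] -/
def capSum (H : Finset (Fin n)) (h : ℕ) (U : Finset (Fin n)) : ℝ := 2 * ((U ∩ H).card : ℝ) - 2 * (h : ℝ) + 1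

/-- The cap `f_{H,h}(U) = 1[|U ∩ H| ≥ h] = 1[φ_{H,h}(U) > 0]`. [cite: ODonnell2014, §5.3] -/
def capInd (H : Finset (Fin n)) (h : ℕ) (U : Finset (Fin n)) : ℝ := if 0 < capSum H h U then 1 else 0

/-- The cap deficiency `δ(n,t,N,h) = C(N−1,h−1)² / (C(n,t)·Z(n,t,N))` (`= deficiency n t N` at the median `h = (N+1)/2` of an
odd block). [folklore] -/
def capDeficiency (n t N h : ℕ) : ℝ :=
  (((N - 1).choose (h - 1) : ℕ) : ℝ) ^ 2 / ((n.choose t : ℝ) * hahnNormSq n t N)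

/-- `capInd H h U = 1[h ≤ |U ∩ H|]`. [cite: ODonnell2014, §5.3] -/
theorem capInd_eq (H : Finset (Fin n)) (h : ℕ) (U : Finset (Fin n)) :
    capInd H h U = if h ≤ (U ∩ H).card then 1 else 0 := by
  unfold capInd capSum
  by_cases hle : h ≤ (U ∩ H).card
  · have : (h : ℝ) ≤ ((U ∩ H).card : ℝ) := by exact_mod_cast hle
    rw [if_pos (by linarith), if_pos hle]
  · have : ((U ∩ H).card : ℝ) + 1 ≤ (h : ℝ) := by exact_mod_cast (by omega : (U ∩ H).card + 1 ≤ h)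
    rw [if_neg (by linarith), if_neg hle]

/-- The block majority of an odd block is its median cap: `blockMaj H = capInd H (N'+1)` for `|H| = 2N'+1`.
[cite: ODonnell2014, §5.3] -/
theorem blockMaj_eq_capInd {N' : ℕ} (H : Finset (Fin n)) (hH : H.card = 2 * N' + 1) (U : Finset (Fin n)) :
    blockMaj H U = capInd H (N' + 1) U := by
  have hφ : blockSum H U = capSum H (N' + 1) U := by
    unfold blockSum capSum; rw [hH]; push_cast; ring
  unfold blockMaj capInd
  rw [hφ]

/-- `|φ_{H,h}| ≥ 1` (odd integer). [cite: ODonnell2014, §5.3 (n odd)] -/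
theorem one_le_abs_capSum (H : Finset (Fin n)) (h : ℕ) (U : Finset (Fin n)) : 1 ≤ |capSum H h U| := by
  have hz : capSum H h U = (((2 * (((U ∩ H).card : ℤ) - (h : ℤ)) + 1) : ℤ) : ℝ) := by
    unfold capSum; push_cast; ring
  have hodd : Odd (2 * (((U ∩ H).card : ℤ) - (h : ℤ)) + 1) := odd_two_mul_add_one _
  have hne : (2 * (((U ∩ H).card : ℤ) - (h : ℤ)) + 1) ≠ 0 := by
    rintro h0; rw [h0] at hodd; exact (Int.not_odd_iff_even.2 (by decide : Even (0 : ℤ))) hodd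
  rw [hz, ← Int.cast_abs]
  exact_mod_cast Int.one_le_abs hne

/-- **The top Hahn coefficient of a cap**: `Σ_{U ∈ C([n],t)} f_{H,h}(U)·Ψ_H(U) = Σ_{j ≥ h} (−1)^j C(N,j) = (−1)^h C(N−1,h−1)`
for `1 ≤ h ≤ N = |H| ≤ t`, `N + t ≤ n`. [cite: ODonnell2014, Thm. 5.19 and Cor. 5.20 (§5.3: the binomial identity behind the
coefficients of majority)] -/
theorem sum_capInd_mul_hahnTop {t h : ℕ} (H : Finset (Fin n)) (hh1 : 1 ≤ h) (hhN : h ≤ H.card) (hHt : H.card ≤ t)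
    (hHn : H.card + t ≤ n) :
    ∑ U ∈ slice n t, capInd H h U * hahnTop n t H U = (-1) ^ h * ((((H.card - 1).choose (h - 1)) : ℕ) : ℝ) := by
  set G : ℕ → ℝ := fun j => (if h ≤ j then 1 else 0) * hahnCoeff n t H.card j with hG
  have h1 : ∀ U ∈ slice n t, capInd H h U * hahnTop n t H U = G (U ∩ H).card := by
    intro U _; rw [capInd_eq]; rfl
  rw [sum_congr rfl h1, sum_slice_radial H hHt G]
  have h2 : ∀ j ∈ range (H.card + 1), ((H.card.choose j : ℕ) : ℝ) * ((((n - H.card).choose (t - j) : ℕ) : ℝ) * G j) =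
      (-1 : ℝ) ^ j * ((H.card.choose j : ℕ) : ℝ) -
        (if j < h then (-1 : ℝ) ^ j * ((H.card.choose j : ℕ) : ℝ) else 0) := by
    intro j hj
    have hpos : (0 : ℝ) < (((n - H.card).choose (t - j) : ℕ) : ℝ) := by
      have := mem_range.1 hj
      exact_mod_cast Nat.choose_pos (by omega)
    rw [hG]
    unfold hahnCoeff
    by_cases hjs : j < h
    · simp only [if_neg (show ¬ h ≤ j by omega), if_pos hjs]
      ring
    · simp only [if_pos (show h ≤ j by omega), if_neg hjs]
      field_simp
      ring
  rw [sum_congr rfl h2, sum_sub_distrib, ← sum_filter]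
  have hfull : ∑ j ∈ range (H.card + 1), (-1 : ℝ) ^ j * ((H.card.choose j : ℕ) : ℝ) = 0 := by
    have := Int.alternating_sum_range_choose_of_ne (n := H.card) (by omega)
    exact_mod_cast this
  have hflt : (range (H.card + 1)).filter (fun j => j < h) = range (h - 1 + 1) := by
    ext j; simp only [mem_filter, mem_range]; omega
  obtain ⟨N₁, hN₁⟩ : ∃ N₁, H.card = N₁ + 1 := ⟨H.card - 1, by omega⟩
  rw [hfull, hflt, hN₁, alternating_partial_sum N₁ (h - 1), show N₁ + 1 - 1 = N₁ by omega]
  obtain ⟨h', rfl⟩ : ∃ h', h = h' + 1 := ⟨h - 1, by omega⟩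
  rw [show h' + 1 - 1 = h' by omega, pow_succ]
  ring

/-- **Caps are not moment-matched by bounded functions orthogonal to the top Hahn vector**: for `1 ≤ h ≤ |H| ≤ t`,
`|H| + t ≤ n` and every `g : C([n],t) → [0,1]` with `Σ_U g Ψ_H = 0`:
`Σ_U φ_{H,h}(U)·(f_{H,h}(U) − g(U)) ≥ C(|H|−1,h−1)² / Z(n,t,|H|)`. [cite: ODonnell2014, Thm. 5.19 and Cor. 5.20 (§5.3: cube analogue)] -/
theorem sum_capSum_mul_sub_ge {t h : ℕ} (H : Finset (Fin n)) (hh1 : 1 ≤ h) (hhN : h ≤ H.card) (hHt : H.card ≤ t)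
    (hHn : H.card + t ≤ n) (g : Finset (Fin n) → ℝ) (hg : ∀ U ∈ slice n t, 0 ≤ g U ∧ g U ≤ 1)
    (horth : ∑ U ∈ slice n t, g U * hahnTop n t H U = 0) :
    ((((H.card - 1).choose (h - 1)) : ℕ) : ℝ) ^ 2 / hahnNormSq n t H.card ≤
      ∑ U ∈ slice n t, capSum H h U * (capInd H h U - g U) := by
  have h1 : ∑ U ∈ slice n t, (capInd H h U - g U) ^ 2 ≤ ∑ U ∈ slice n t, capSum H h U * (capInd H h U - g U) :=
    sum_le_sum fun U hU => sq_sub_le_mul_sub (one_le_abs_capSum H h U) (hg U hU).1 (hg U hU).2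
  have hcs := sum_mul_sq_le_sq_mul_sq (slice n t) (fun U => capInd H h U - g U) (fun U => hahnTop n t H U)
  have hinner : ∑ U ∈ slice n t, (capInd H h U - g U) * hahnTop n t H U =
      (-1) ^ h * ((((H.card - 1).choose (h - 1)) : ℕ) : ℝ) := by
    simp_rw [sub_mul]
    rw [sum_sub_distrib, horth, sub_zero, sum_capInd_mul_hahnTop H hh1 hhN hHt hHn]
  rw [hinner, sum_hahnTop_sq H hHt hHn] at hcs
  have hsq : ((-1 : ℝ) ^ h * ((((H.card - 1).choose (h - 1)) : ℕ) : ℝ)) ^ 2 =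
      ((((H.card - 1).choose (h - 1)) : ℕ) : ℝ) ^ 2 := by
    rw [mul_pow, ← pow_mul, Even.neg_one_pow ⟨h, by ring⟩, one_mul]
  rw [hsq] at hcs
  have hZ := hahnNormSq_pos (n := n) hHn
  rw [div_le_iff₀ hZ]
  calc ((((H.card - 1).choose (h - 1)) : ℕ) : ℝ) ^ 2
      ≤ (∑ U ∈ slice n t, (capInd H h U - g U) ^ 2) * hahnNormSq n t H.card := hcs
    _ ≤ (∑ U ∈ slice n t, capSum H h U * (capInd H h U - g U)) * hahnNormSq n t H.card :=
        mul_le_mul_of_nonneg_right h1 hZ.le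

/-- **Expectation form for caps, every threshold and block size** (LIT-41 §4(2)'s test family): for `1 ≤ h ≤ |H| ≤ t`,
`|H| + t ≤ n` and every `g : C([n],t) → [0,1]` of Johnson degree `≤ d < |H|` on the slice,
`E_U[φ_{H,h}(U)·(f_{H,h}(U) − g(U))] ≥ C(|H|−1,h−1)² / (C(n,t)·Z(n,t,|H|))`.
[cite: FilmusIhringer2019, §2 (p. 4: degree on a domain)] [cite: ODonnell2014, Thm. 5.19 and Cor. 5.20 (§5.3)] -/
theorem expect_capSum_mul_sub_ge {t d h : ℕ} (H : Finset (Fin n)) (hh1 : 1 ≤ h) (hhN : h ≤ H.card) (hHt : H.card ≤ t)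
    (hHn : H.card + t ≤ n) (hd : d < H.card) (g : Finset (Fin n) → ℝ) (hg : ∀ U ∈ slice n t, 0 ≤ g U ∧ g U ≤ 1)
    (hdeg : HasDegreeLEOn (slice n t) d g) :
    capDeficiency n t H.card h ≤ (∑ U ∈ slice n t, capSum H h U * (capInd H h U - g U)) / (n.choose t : ℝ) := by
  have hmain := sum_capSum_mul_sub_ge H hh1 hhN hHt hHn g hg
    (sum_mul_hahnTop_eq_zero_of_hasDegreeLEOn hHt hHn hd hdeg)
  have hC : (0 : ℝ) < (n.choose t : ℝ) := by exact_mod_cast Nat.choose_pos (by omega)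
  have hZ := hahnNormSq_pos (n := n) hHn
  rw [le_div_iff₀ hC]
  unfold capDeficiency
  calc ((((H.card - 1).choose (h - 1)) : ℕ) : ℝ) ^ 2 / ((n.choose t : ℝ) * hahnNormSq n t H.card) * (n.choose t : ℝ)
      = ((((H.card - 1).choose (h - 1)) : ℕ) : ℝ) ^ 2 / hahnNormSq n t H.card := by
        field_simp
    _ ≤ ∑ U ∈ slice n t, capSum H h U * (capInd H h U - g U) := hmain

/-! ### §9 The exact second moment of the block sum and the sharp normalisation (LIT-41 §3's column `δ/‖φ‖₂`)

The hypergeometric first two moments of `|U ∩ H|` by double counting (`Σ_U |U∩H| = N·C(n−1,t−1)`,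
`Σ_U |U∩H|² = N·C(n−1,t−1) + N(N−1)·C(n−2,t−2)`), hence `Σ_U φ_H² = 4Σ|U∩H|² − 4NΣ|U∩H| + N²·C(n,t)` in closed form
(`blockSumSqSum`), and the barrier with the EXACT normalisation `ε < δ(n,t,N)/‖φ_H‖₂`, `‖φ_H‖₂² = blockSumSqSum/C(n,t)`
(removing scope caveat (a) of the module docstring for the median witness). -/

/-- `Σ_{U ∈ C([n],t)} φ_H(U)²` in closed form: `4(N·C(n−1,t−1) + N(N−1)·C(n−2,t−2)) − 4N·N·C(n−1,t−1) + N²·C(n,t)` (`N = |H|`).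
[cite: MacWilliamsSloane1977, Ch. 21 §6 Problem (11) (PDF p. 516: row sums of the containment matrices A_1, A_2)] -/
def blockSumSqSum (n t N : ℕ) : ℝ :=
  4 * ((N : ℝ) * ((n - 1).choose (t - 1) : ℕ) + (N : ℝ) * ((N : ℝ) - 1) * ((n - 2).choose (t - 2) : ℕ)) -
    4 * (N : ℝ) * ((N : ℝ) * ((n - 1).choose (t - 1) : ℕ)) + (N : ℝ) ^ 2 * (n.choose t : ℝ)

/-- The number of `t`-subsets of `[n]` containing a given set `A` with `|A| ≤ t` is `C(n−|A|, t−|A|)` (row sums of the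
containment matrix). [cite: MacWilliamsSloane1977, Ch. 21 §6 Problem (11) (PDF p. 516)] -/
theorem card_slice_filter_superset {t : ℕ} (A : Finset (Fin n)) (hA : A.card ≤ t) :
    ((slice n t).filter (A ⊆ ·)).card = (n - A.card).choose (t - A.card) := by
  classical
  rw [show slice n t = powersetCard t (univ : Finset (Fin n)) from rfl,
    card_filter_powersetCard_subset A univ t (subset_univ A) hA, card_univ, Fintype.card_fin]

/-- **First moment**: `Σ_{U ∈ C([n],t)} |U ∩ H| = |H|·C(n−1,t−1)` for `1 ≤ t` (double counting over `i ∈ H`).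
[cite: MacWilliamsSloane1977, Ch. 21 §6 Problem (11) (PDF p. 516)] -/
theorem sum_slice_blockCard {t : ℕ} (H : Finset (Fin n)) (ht : 1 ≤ t) :
    ∑ U ∈ slice n t, ((U ∩ H).card : ℝ) = (H.card : ℝ) * (((n - 1).choose (t - 1) : ℕ) : ℝ) := by
  classical
  have hcard : ∀ U : Finset (Fin n), ((U ∩ H).card : ℝ) = ∑ i ∈ H, (if i ∈ U then (1 : ℝ) else 0) := by
    intro U
    rw [← natCast_card_filter, filter_mem_eq_inter, inter_comm]
  simp_rw [hcard]
  rw [sum_comm]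
  have hinner : ∀ i ∈ H, ∑ U ∈ slice n t, (if i ∈ U then (1 : ℝ) else 0) = (((n - 1).choose (t - 1) : ℕ) : ℝ) := by
    intro i _
    rw [sum_boole]
    have h1 : (slice n t).filter (fun U => i ∈ U) = (slice n t).filter (({i} : Finset (Fin n)) ⊆ ·) := by
      refine filter_congr fun U _ => ?_
      rw [singleton_subset_iff]
    rw [h1, card_slice_filter_superset {i} (by simpa using ht), card_singleton]
  rw [sum_congr rfl hinner, sum_const, nsmul_eq_mul]

/-- **Second moment**: `Σ_{U ∈ C([n],t)} |U ∩ H|² = |H|·C(n−1,t−1) + |H|(|H|−1)·C(n−2,t−2)` for `|H| ≤ t`, `1 ≤ t`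
(double counting over ordered pairs `(i,j) ∈ H²`). [cite: MacWilliamsSloane1977, Ch. 21 §6 Problem (11) (PDF p. 516: C_i = A_i A_iᵀ)] -/
theorem sum_slice_blockCard_sq {t : ℕ} (H : Finset (Fin n)) (hHt : H.card ≤ t) (ht : 1 ≤ t) :
    ∑ U ∈ slice n t, ((U ∩ H).card : ℝ) ^ 2 =
      (H.card : ℝ) * (((n - 1).choose (t - 1) : ℕ) : ℝ) + (H.card : ℝ) * ((H.card : ℝ) - 1) * (((n - 2).choose (t - 2) : ℕ) : ℝ) := by
  classical
  have hcard : ∀ U : Finset (Fin n), ((U ∩ H).card : ℝ) = ∑ i ∈ H, (if i ∈ U then (1 : ℝ) else 0) := by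
    intro U
    rw [← natCast_card_filter, filter_mem_eq_inter, inter_comm]
  have hsq : ∀ U : Finset (Fin n), ((U ∩ H).card : ℝ) ^ 2 =
      ∑ i ∈ H, ∑ j ∈ H, (if ({i, j} : Finset (Fin n)) ⊆ U then (1 : ℝ) else 0) := by
    intro U
    rw [sq, hcard, sum_mul_sum]
    refine sum_congr rfl fun i _ => sum_congr rfl fun j _ => ?_
    by_cases hi : i ∈ U <;> by_cases hj : j ∈ U <;> simp [hi, hj, insert_subset_iff]
  simp_rw [hsq]
  rw [sum_comm]
  simp_rw [sum_comm (s := slice n t)]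
  -- inner counts
  have hpair : ∀ i ∈ H, ∀ j ∈ H, ∑ U ∈ slice n t, (if ({i, j} : Finset (Fin n)) ⊆ U then (1 : ℝ) else 0) =
      if i = j then (((n - 1).choose (t - 1) : ℕ) : ℝ) else (((n - 2).choose (t - 2) : ℕ) : ℝ) := by
    intro i hi j hj
    rw [sum_boole, card_slice_filter_superset]
    · by_cases hij : i = j
      · subst hij; simp
      · rw [if_neg hij, card_pair hij]
    · by_cases hij : i = j
      · subst hij; simpa using ht
      · rw [card_pair hij]
        have : ({i, j} : Finset (Fin n)).card ≤ H.card := card_le_card (by simp [insert_subset_iff, hi, hj])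
        rw [card_pair hij] at this
        omega
  rw [sum_congr rfl fun i hi => sum_congr rfl fun j hj => hpair i hi j hj]
  -- Σ_{i,j∈H} (if i = j then a else b) = N·a + N(N−1)·b
  set a : ℝ := (((n - 1).choose (t - 1) : ℕ) : ℝ)
  set b : ℝ := (((n - 2).choose (t - 2) : ℕ) : ℝ)
  have hrow : ∀ i ∈ H, ∑ j ∈ H, (if i = j then a else b) = a + ((H.card : ℝ) - 1) * b := by
    intro i hi
    rw [← sum_filter_add_sum_filter_not H (fun j => i = j)]
    have h1 : H.filter (fun j => i = j) = {i} := by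
      ext j; simp only [mem_filter, mem_singleton]; constructor
      · rintro ⟨_, rfl⟩; rfl
      · rintro rfl; exact ⟨hi, rfl⟩
    have h2 : (H.filter (fun j => ¬ i = j)).card = H.card - 1 := by
      have := card_filter_add_card_filter_not (s := H) (fun j => i = j)
      rw [h1, card_singleton] at this
      omega
    rw [h1, sum_singleton, if_pos rfl, sum_congr rfl fun j hj => if_neg (mem_filter.1 hj).2, sum_const, h2, nsmul_eq_mul]
    have hN1 : 1 ≤ H.card := card_pos.2 ⟨i, hi⟩
    rw [Nat.cast_sub hN1, Nat.cast_one]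
  rw [sum_congr rfl hrow, sum_const, nsmul_eq_mul]
  ring

/-- **`Σ_{U ∈ C([n],t)} φ_H(U)² = blockSumSqSum n t |H|`** for `|H| ≤ t`, `1 ≤ t`. [cite: MacWilliamsSloane1977, Ch. 21 §6 Problem (11) (PDF p. 516)] -/
theorem sum_blockSum_sq_eq {t : ℕ} (H : Finset (Fin n)) (hHt : H.card ≤ t) (ht : 1 ≤ t) :
    ∑ U ∈ slice n t, blockSum H U ^ 2 = blockSumSqSum n t H.card := by
  have hexp : ∀ U ∈ slice n t, blockSum H U ^ 2 =
      4 * ((U ∩ H).card : ℝ) ^ 2 - 4 * (H.card : ℝ) * ((U ∩ H).card : ℝ) + (H.card : ℝ) ^ 2 := by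
    intro U _; unfold blockSum; ring
  rw [sum_congr rfl hexp, sum_add_distrib, sum_sub_distrib, ← mul_sum, ← mul_sum, sum_const, SliceFKN.card_slice,
    nsmul_eq_mul, sum_slice_blockCard_sq H hHt ht, sum_slice_blockCard H ht]
  unfold blockSumSqSum
  ring

/-- `Σ_U φ_H² ≥ C(n,t) > 0` (`φ_H² ≥ 1` pointwise for `|H|` odd). [cite: ODonnell2014, §5.3 (n odd)] -/
theorem blockSumSqSum_pos {t N' : ℕ} (H : Finset (Fin n)) (hH : H.card = 2 * N' + 1) (hHt : H.card ≤ t)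
    (hHn : H.card + t ≤ n) : 0 < blockSumSqSum n t H.card := by
  have ht : 1 ≤ t := by omega
  rw [← sum_blockSum_sq_eq H hHt ht]
  have hC : (0 : ℝ) < (n.choose t : ℝ) := by exact_mod_cast Nat.choose_pos (by omega)
  have h1 : ∀ U ∈ slice n t, (1 : ℝ) ≤ blockSum H U ^ 2 := by
    intro U _
    have := one_le_abs_blockSum (H := H) ⟨N', hH⟩ U
    have h2 : (1 : ℝ) ≤ |blockSum H U| ^ 2 := by nlinarith [abs_nonneg (blockSum H U)]
    rwa [sq_abs] at h2
  calc (0 : ℝ) < (n.choose t : ℝ) := hC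
    _ = ∑ U ∈ slice n t, (1 : ℝ) := by rw [sum_const, SliceFKN.card_slice, nsmul_eq_mul, mul_one]
    _ ≤ ∑ U ∈ slice n t, blockSum H U ^ 2 := sum_le_sum h1

/-- **BARRIER, sharp normalisation** (LIT-41 §3's `δ/‖φ‖₂` column exactly): for `N = 2N'+1 ≤ t`, `N + t ≤ n`, every `d < N`
and every `ε < δ(n,t,N) / ‖φ_H‖₂` with `‖φ_H‖₂² = blockSumSqSum n t N / C(n,t)` (the exact hypergeometric second moment of the
block sum), `SliceMomentMatching n t d ε` fails. [cite: ODonnell2014, Thm. 5.19 and Cor. 5.20 (§5.3: cube analogue)]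
[cite: FilmusIhringer2019, §2 (p. 4)] -/
theorem not_sliceMomentMatching_sharp {t d N' : ℕ} (hNt : 2 * N' + 1 ≤ t) (hNn : 2 * N' + 1 + t ≤ n)
    (hd : d < 2 * N' + 1) {ε : ℝ}
    (hε : ε < deficiency n t (2 * N' + 1) / Real.sqrt (blockSumSqSum n t (2 * N' + 1) / (n.choose t : ℝ))) :
    ¬ SliceMomentMatching n t d ε := by
  classical
  intro h
  obtain ⟨H, -, hH⟩ := exists_subset_card_eq (s := (univ : Finset (Fin n))) (n := 2 * N' + 1)
    (by rw [card_univ, Fintype.card_fin]; omega)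
  have hHt : H.card ≤ t := by rw [hH]; exact hNt
  have hHn : H.card + t ≤ n := by rw [hH]; exact hNn
  have ht : 1 ≤ t := by omega
  obtain ⟨g, hg01, hgdeg, hgε⟩ := h (blockSum H) (hasDegreeLEOn_blockSum _ H)
  have hlow := expect_blockSum_mul_sub_ge H hH hHt hHn (by rw [hH]; exact hd) g hg01 hgdeg
  have hC : (0 : ℝ) < (n.choose t : ℝ) := by exact_mod_cast Nat.choose_pos (by omega)
  have hδ := deficiency_pos (n := n) hNn
  have hS := blockSumSqSum_pos H hH hHt hHn
  rw [hH] at hS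
  rw [hH, le_div_iff₀ hC] at hlow
  have hind : ∀ U, (if 0 < blockSum H U then (1 : ℝ) else 0) = blockMaj H U := fun U => rfl
  simp_rw [hind] at hgε
  rw [sum_blockSum_sq_eq H hHt ht, hH] at hgε
  -- `√(C(n,t)·S) = C(n,t)·√(S/C(n,t))`
  set S : ℝ := blockSumSqSum n t (2 * N' + 1) with hSdef
  have hroot : Real.sqrt ((n.choose t : ℝ) * S) = (n.choose t : ℝ) * Real.sqrt (S / (n.choose t : ℝ)) := by
    have h1 : (n.choose t : ℝ) * S = (n.choose t : ℝ) ^ 2 * (S / (n.choose t : ℝ)) := by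
      field_simp
    rw [h1, Real.sqrt_mul (by positivity), Real.sqrt_sq hC.le]
  rw [hroot] at hgε
  have hr : 0 < Real.sqrt (S / (n.choose t : ℝ)) := Real.sqrt_pos.2 (div_pos hS hC)
  rw [lt_div_iff₀ hr] at hε
  by_cases hε0 : 0 ≤ ε
  · have : deficiency n t (2 * N' + 1) * (n.choose t : ℝ) ≤ ε * ((n.choose t : ℝ) * Real.sqrt (S / (n.choose t : ℝ))) :=
      hlow.trans hgε
    nlinarith
  · have hε0' : ε < 0 := not_le.1 hε0
    have : ε * ((n.choose t : ℝ) * Real.sqrt (S / (n.choose t : ℝ))) < 0 := mul_neg_of_neg_of_pos hε0' (by positivity)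
    nlinarith

/-! ### §10 Block symmetrisation on the slice (Minsky–Papert over `S_H × S_{[n]∖H}`)

The symmetrisation identity of §2 in polynomial dress, for arbitrary coefficient vectors: a function of Johnson degree `≤ d` on
`C([n],t)`, summed over the `U` with `|U ∩ H| = j`, is `C(N,j)·C(n−N,t−j)` times a univariate real polynomial of degree `≤ d`
evaluated at `j` — the block (two-orbit) analogue on the slice of Minsky–Papert symmetrisation
(`Literature.Computability.QuantumComplexity.symPoly`, Beals–Buhrman–Cleve–Mosca–de Wolf Lemma 3.2, which is the cube
statement in the weight variable). -/

/-- The binomial polynomial `X(X−1)⋯(X−a+1)/a!` (value `C(j,a)` at a natural number `j`).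
[cite: BealsEtAl2001, Lemma 3.2 ("V_j assumes value C(|X|,j) on X, a polynomial of degree j of |X|")] -/
def binomPoly (a : ℕ) : Polynomial ℝ := Polynomial.C ((a.factorial : ℝ)⁻¹) * descPochhammer ℝ a

/-- `binomPoly a` at a natural number `j` is `C(j,a)`. [cite: BealsEtAl2001, Lemma 3.2] -/
theorem binomPoly_eval_natCast (a j : ℕ) : (binomPoly a).eval (j : ℝ) = ((j.choose a : ℕ) : ℝ) := by
  unfold binomPoly
  rw [Polynomial.eval_mul, Polynomial.eval_C, descPochhammer_eval_eq_descFactorial ℝ j a,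
    Nat.descFactorial_eq_factorial_mul_choose]
  have h : (a.factorial : ℝ) ≠ 0 := by positivity
  push_cast
  field_simp

/-- `deg binomPoly a ≤ a`. [cite: BealsEtAl2001, Lemma 3.2] -/
theorem natDegree_binomPoly_le (a : ℕ) : (binomPoly a).natDegree ≤ a := by
  unfold binomPoly
  refine (Polynomial.natDegree_C_mul_le _ _).trans ?_
  rw [descPochhammer_natDegree]

/-- The reflected binomial polynomial `C(t − X, b)` (value `C(t−j,b)` at naturals `j ≤ t`). [cite: BealsEtAl2001, Lemma 3.2] -/
def binomPolyRefl (t b : ℕ) : Polynomial ℝ := (binomPoly b).comp (Polynomial.C (t : ℝ) - Polynomial.X)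

/-- `binomPolyRefl t b` at a natural number `j ≤ t` is `C(t−j,b)`. [cite: BealsEtAl2001, Lemma 3.2] -/
theorem binomPolyRefl_eval_natCast {t j : ℕ} (hj : j ≤ t) (b : ℕ) :
    (binomPolyRefl t b).eval (j : ℝ) = (((t - j).choose b : ℕ) : ℝ) := by
  unfold binomPolyRefl
  rw [Polynomial.eval_comp, Polynomial.eval_sub, Polynomial.eval_C, Polynomial.eval_X,
    show (t : ℝ) - (j : ℝ) = ((t - j : ℕ) : ℝ) by rw [Nat.cast_sub hj], binomPoly_eval_natCast]

/-- `deg binomPolyRefl t b ≤ b`. [cite: BealsEtAl2001, Lemma 3.2] -/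
theorem natDegree_binomPolyRefl_le (t b : ℕ) : (binomPolyRefl t b).natDegree ≤ b := by
  unfold binomPolyRefl
  refine Polynomial.natDegree_comp_le.trans ?_
  have h1 : (Polynomial.C (t : ℝ) - Polynomial.X).natDegree ≤ 1 :=
    (Polynomial.natDegree_sub_le _ _).trans (by simp)
  calc (binomPoly b).natDegree * (Polynomial.C (t : ℝ) - Polynomial.X).natDegree
      ≤ b * 1 := Nat.mul_le_mul (natDegree_binomPoly_le b) h1
    _ = b := mul_one b

/-- The block-symmetrised polynomial of a coefficient vector `v` (the function `U ↦ Σ_{A ⊆ U} v_A = zeta v U`):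
`Σ_A v_A/(C(N,|A∩H|)·C(n−N,|A∖H|)) · C(X,|A∩H|)·C(t−X,|A∖H|)`, `N = |H|`. [cite: BealsEtAl2001, Lemma 3.2 (block analogue)]
[cite: MacWilliamsSloane1977, Ch. 21 §6 Problems (10)–(11) (PDF p. 516)] -/
def blockSymPoly (n t : ℕ) (H : Finset (Fin n)) (v : Finset (Fin n) → ℝ) : Polynomial ℝ :=
  ∑ A : Finset (Fin n), Polynomial.C (v A / (((H.card.choose (A ∩ H).card : ℕ) : ℝ) * (((n - H.card).choose (A \ H).card : ℕ) : ℝ))) *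
    (binomPoly (A ∩ H).card * binomPolyRefl t (A \ H).card)

/-- `deg blockSymPoly ≤ d` when `v` is supported on sets of size `≤ d`. [cite: BealsEtAl2001, Lemma 3.2 ("of degree at most the degree of p")] -/
theorem natDegree_blockSymPoly_le {t d : ℕ} (H : Finset (Fin n)) {v : Finset (Fin n) → ℝ}
    (hv : ∀ A, d < A.card → v A = 0) : (blockSymPoly n t H v).natDegree ≤ d := by
  unfold blockSymPoly
  refine Polynomial.natDegree_sum_le_of_forall_le _ _ fun A _ => ?_
  by_cases hA : d < A.card
  · rw [hv A hA, zero_div, map_zero, zero_mul, Polynomial.natDegree_zero]; exact Nat.zero_le _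
  · refine (Polynomial.natDegree_C_mul_le _ _).trans (Polynomial.natDegree_mul_le.trans ?_)
    have hab : (A ∩ H).card + (A \ H).card = A.card := card_inter_add_card_sdiff A H
    calc (binomPoly (A ∩ H).card).natDegree + (binomPolyRefl t (A \ H).card).natDegree
        ≤ (A ∩ H).card + (A \ H).card := Nat.add_le_add (natDegree_binomPoly_le _) (natDegree_binomPolyRefl_le _ _)
      _ ≤ d := by omega

/-- **Block symmetrisation on the slice**: for `|H| = N ≤ t`, a coefficient vector `v` and every `j`,
`Σ_{U ∈ C([n],t), |U∩H| = j} zeta v U = C(N,j)·C(n−N,t−j)·(blockSymPoly n t H v)(j)` — the average of a Johnson-degree-`≤ d` function over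
the sets meeting `H` in exactly `j` points is a polynomial of degree `≤ d` in `j` (`natDegree_blockSymPoly_le`).
[cite: BealsEtAl2001, Lemma 3.2 (Minsky–Papert symmetrisation; here over the two blocks H, [n]∖H of the slice)]
[cite: MacWilliamsSloane1977, Ch. 21 §6 Problems (10)–(11) (PDF p. 516)] -/
theorem sum_slice_filter_blockCard_zeta {t : ℕ} (H : Finset (Fin n)) (hHt : H.card ≤ t)
    (v : Finset (Fin n) → ℝ) (j : ℕ) :
    ∑ U ∈ (slice n t).filter (fun U => (U ∩ H).card = j), JohnsonHarmonics.zeta v U =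
      ((H.card.choose j : ℕ) : ℝ) * ((((n - H.card).choose (t - j) : ℕ) : ℝ) * (blockSymPoly n t H v).eval (j : ℝ)) := by
  classical
  by_cases hjN : H.card < j
  · -- both sides vanish
    have h0 : (slice n t).filter (fun U => (U ∩ H).card = j) = ∅ := by
      refine filter_eq_empty_iff.2 fun U _ hU => ?_
      have := card_le_card (inter_subset_right : U ∩ H ⊆ H); omega
    rw [h0, sum_empty, Nat.choose_eq_zero_of_lt hjN, Nat.cast_zero, zero_mul]
  have hjN' : j ≤ H.card := not_lt.1 hjN
  have hjt : j ≤ t := hjN'.trans hHt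
  -- left-hand side, set by set
  have hL : ∑ U ∈ (slice n t).filter (fun U => (U ∩ H).card = j), JohnsonHarmonics.zeta v U =
      ∑ A : Finset (Fin n), v A * ((((slice n t).filter (fun U => A ⊆ U ∧ (U ∩ H).card = j)).card : ℕ) : ℝ) := by
    have hexp : ∀ U ∈ (slice n t).filter (fun U => (U ∩ H).card = j), JohnsonHarmonics.zeta v U =
        ∑ A : Finset (Fin n), v A * (if A ⊆ U then (1 : ℝ) else 0) := by
      intro U _
      rw [JohnsonHarmonics.zeta_apply]
      have hpow : U.powerset = univ.filter (fun A => A ⊆ U) := by ext A; simp [mem_powerset]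
      rw [hpow, sum_filter]
      exact sum_congr rfl fun A _ => by split_ifs <;> simp
    rw [sum_congr rfl hexp, sum_comm]
    refine sum_congr rfl fun A _ => ?_
    rw [← mul_sum, natCast_card_filter, sum_filter]
    congr 1
    refine sum_congr rfl fun U _ => ?_
    by_cases h1 : (U ∩ H).card = j <;> by_cases h2 : A ⊆ U <;> simp [h1, h2]
  rw [hL]
  unfold blockSymPoly
  rw [Polynomial.eval_finsetSum, mul_sum, mul_sum]
  refine sum_congr rfl fun A _ => ?_
  rw [Polynomial.eval_mul, Polynomial.eval_C, Polynomial.eval_mul, binomPoly_eval_natCast,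
    binomPolyRefl_eval_natCast hjt]
  have hcnt := card_slice_superset_blockCard_mul H A hHt j
  have ha : (0 : ℝ) < ((H.card.choose (A ∩ H).card : ℕ) : ℝ) := by
    exact_mod_cast Nat.choose_pos (card_le_card inter_subset_right)
  have hb : (0 : ℝ) < (((n - H.card).choose (A \ H).card : ℕ) : ℝ) := by
    have : (A \ H).card ≤ n - H.card := by
      have := card_le_card (sdiff_subset_sdiff (subset_univ A) (le_refl H))
      rwa [card_univ_sdiff, Fintype.card_fin] at this
    exact_mod_cast Nat.choose_pos this
  have hcnt' : ((((slice n t).filter (fun U => A ⊆ U ∧ (U ∩ H).card = j)).card : ℕ) : ℝ) =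
      ((H.card.choose j : ℕ) : ℝ) * ((j.choose (A ∩ H).card : ℕ) : ℝ) *
        ((((n - H.card).choose (t - j) : ℕ) : ℝ) * (((t - j).choose (A \ H).card : ℕ) : ℝ)) /
        (((H.card.choose (A ∩ H).card : ℕ) : ℝ) * (((n - H.card).choose (A \ H).card : ℕ) : ℝ)) := by
    rw [eq_div_iff (by positivity)]
    exact_mod_cast hcnt
  rw [hcnt']
  field_simp

/-- **Corollary (LIT-41 §1 (iii) in full)**: every `g` of Johnson degree `≤ d` on the slice has a block symmetrisation — a real
polynomial `P` of degree `≤ d` with `Σ_{U ∈ C([n],t), |U∩H| = j} g(U) = C(N,j)C(n−N,t−j)·P(j)` for every `j`, hence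
`Σ_{U ∈ C([n],t)} g(U)·F(|U∩H|) = Σ_{j ≤ N} C(N,j)C(n−N,t−j)·P(j)·F(j)` for every `F`. [cite: BealsEtAl2001, Lemma 3.2 (block analogue)]
[cite: FilmusIhringer2019, §2 (p. 4: degree on a domain)] -/
theorem exists_blockSymmetrisation {t d : ℕ} (H : Finset (Fin n)) (hHt : H.card ≤ t)
    {g : Finset (Fin n) → ℝ} (hg : HasDegreeLEOn (slice n t) d g) :
    ∃ P : Polynomial ℝ, P.natDegree ≤ d ∧
      (∀ j : ℕ, ∑ U ∈ (slice n t).filter (fun U => (U ∩ H).card = j), g U =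
        ((H.card.choose j : ℕ) : ℝ) * ((((n - H.card).choose (t - j) : ℕ) : ℝ) * P.eval (j : ℝ))) ∧
      ∀ F : ℕ → ℝ, ∑ U ∈ slice n t, g U * F (U ∩ H).card =
        ∑ j ∈ range (H.card + 1), ((H.card.choose j : ℕ) : ℝ) * ((((n - H.card).choose (t - j) : ℕ) : ℝ) * (P.eval (j : ℝ) * F j)) := by
  classical
  obtain ⟨v, hv, hgv⟩ := hg
  refine ⟨blockSymPoly n t H v, natDegree_blockSymPoly_le H hv, fun j => ?_, fun F => ?_⟩
  · rw [← sum_slice_filter_blockCard_zeta H hHt v j]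
    exact sum_congr rfl fun U hU => hgv U (mem_filter.1 hU).1
  · have hmaps : ∀ U ∈ slice n t, (U ∩ H).card ∈ range (H.card + 1) := by
      intro U _
      exact mem_range.2 (Nat.lt_succ_of_le (card_le_card inter_subset_right))
    rw [← sum_fiberwise_of_maps_to hmaps]
    refine sum_congr rfl fun j _ => ?_
    have h1 : ∑ U ∈ (slice n t).filter (fun U => (U ∩ H).card = j), g U * F (U ∩ H).card =
        (∑ U ∈ (slice n t).filter (fun U => (U ∩ H).card = j), g U) * F j := by
      rw [sum_mul]
      exact sum_congr rfl fun U hU => by rw [(mem_filter.1 hU).2]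
    rw [h1, sum_congr rfl fun U hU => hgv U (mem_filter.1 hU).1, sum_slice_filter_blockCard_zeta H hHt v j]
    ring

end Literature.Barriers.PneNP.MajorityMomentMatchingSlice

end
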